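import Literature.MathematicalPhysics.QuantumFieldTheory.Balaban1983to89.B9Thm34PPrimeKernelFinal
import Literature.MathematicalPhysics.QuantumFieldTheory.Balaban1983to89.B9Thm34PKernelUniform
import Literature.MathematicalPhysics.QuantumFieldTheory.Balaban1983to89.B9Eq365RemainderKernelUniform

/-!
# `Balaban1983to89.B9Thm34PPrimeKernelUniform` — [Balaban1985BackgroundPropagators] THEOREM 3.4 p. 400 / p. 403, THE `R(U)`-CLAUSE: (3.68) FOR
# `P′(A) = P(U′U) − P(U)` IN THE PRINTED KERNEL FORM `[|P′(A;x,x′)|, |(∇P′(A))(x,x′)|, |(P′(A)∇*)(x,x′)|, |(∇P′(A)∇*)(x,x′)|] ≦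
# Kα₁[1, (Lʲη)⁻¹, (Lʲη)⁻¹, (Lʲη)⁻²](L^{j′}η)^{−d}e^{−(δ₀/4)d(y,y′)}` AND THE `R(U)`-CLAUSE COMPLETE IN KERNEL FORM, BOTH WITH THE CONSTANTS CHOSEN
# BEFORE THE LATTICE: `∃ a₁ > 0 ∃ K ∀ (T_η, k, {Ω_j}, U, …) ∀ α₁ ≦ a₁ ∀ A` (FILE 52 of the Sect. B programme of cell `lit-balaban`, seat r06 gen 21;
# FILE 33's §4/§5 re-quantified)

statement-level skeleton of published theorems with citation tags; proofs where landed; nothing here is a claim about the Yang–Mills mass gap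

CITATION HEADER (lean-in-tree rule).  B9 = T. Bałaban, *Propagators for lattice gauge theories in a background field*, Commun. Math. Phys.
**99** (1985) 389–434 [Balaban1985BackgroundPropagators] (held `paper:balaban1985-cmp99-background-propagators`; journal page = PDF page + 388):
Theorem 3.4 p. 400 [PDF 12] L7–10 «There exists a positive constant a₁ such that the operators G′(U), (Q′(U)G′²(U)Q′*(U))⁻¹, R(U), G(U) extend
to configurations U′U for α₁ ≦ a₁ as analytic functions of A. The extended operators satisfy all the inequalities of Theorems 3.1–3.3
correspondingly»; p. 403 [PDF 15] «These results imply that the operators R(U), P(U) = I − R(U) extend analytically to the domain (3.37) and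
satisfy the same bounds, e.g. the operator P(U′U) satisfies the bounds (3.49). Moreover we have P(U′U) = P(U) + P′(A), |P′(A;x,x′)|,
|(DP′(A))_μ(x,x′)|, |(P′(A)D*)_ν(x,x′)|, |(DP′(A)D*)_{μν}(x,x′)| ≦ O(1)α₁[1, (Lʲη)⁻¹, (Lʲη)⁻¹, (Lʲη)⁻²](L^{j′}η)^{−d}e^{−(1/2)δ₀d(y,y′)} for x ∈ Δ(y),
y ∈ Λ_j, x′ ∈ Δ(y′), y′ ∈ Λ_{j′}. (3.68) The remainder can be written explicitly in terms of the operators introduced until now by writing the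
expansions of the operators determining P(U′U).» (the printed KERNEL shape = `B6RandomWalkKernel.HasKernelBound`, kernels for the pairing of p. 393,
block volume weight `v(y′) = (L^{j′}η)^d`); p. 399 [PDF 11] L1–3 «Let us stress that the constants in the formulations of both theorems do not depend
on the sequence {Ω_j}, j = 0, 1, …, k, if the conditions (2.1), (2.2) are satisfied»; Theorem 3.1 p. 397 [PDF 9] («dependent on d and L only»,
(3.42)); (3.25) p. 394; (3.49) p. 399; (3.57) p. 401, (3.59)–(3.67) pp. 402–403; Theorem 3.2 (3.48) p. 398; the p. 398 scale-transfer remark after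
(3.47); (3.19)/(3.21) pp. 393–394; (3.37) p. 396.  [4] = [Balaban1984PropagatorsII] T. Bałaban, *Propagators and renormalization transformations for
lattice gauge theories. II*, Commun. Math. Phys. **96** (1984) 223–250: Lemma 2.1 p. 234 [PDF 12] (no dependence on the torus, k or {Ω_j}),
(2.51)–(2.55) p. 232, (2.66) p. 234, (2.68) p. 235.  Rows B9.Eq3.68 × B9.Thm3.4 × B9.Eq3.49 × B9.Eq3.66 (cells only; no row head changes).

WHY THIS FILE (B9-CLOSURE §3 item 4, §5 item 2 (M); FILE 33 HONEST SCOPE (iv) «`a₁`, `K` packaged existentially AFTER the lattice is fixed (values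
depend on `d, L, δ₀, B_G, B₁, κ_Q, c_F, C_q, a₀, M₂Σ‖bᵢ‖, d₀` and the scale-transfer constants only)»; INTERFACES-r06 §46/§47 RECIPE).  FILE 33
states (3.68)/(3.49) in the printed kernel form as `∀ (lattice, background, letters) ∃ a₁ ∃ K ∀ α₁ ∀ A`.  Here (as in FILES 45–51) the p. 398 /
[4] Lemma 2.1 scale transfer is hypothesised in its printed uniform form (ONE function `Λ : (0,∞) → [1,∞)` for the family) and the quantifiers are
re-ordered; FILE 33's per-lattice callees are replaced by their uniform twins (FILE 45 `thm34_Gp_uniform`/`thm34_Cinv_uniform`, FILE 49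
`thm34_Gp_kernel_uniform`, FILE 50 `remainder365_kernel_uniform`, FILE 51 `thm34_P_kernel_uniform`), invoked before the lattice.

WHAT IS PROVED (2 theorems: 0 `def`, 0 sorry, 0 new named facts; standard axioms).
* §1 **`thm34_pPrime_kernel_uniform`** — FILE 33 `thm34_pPrime_kernel_final` (THERE EXISTS `C⁻¹(U′U)`, two-sided inverse of
  `Q′(U′U)G′²(U′U)Q′*(U′U)`, such that `P(U′U) = P(U) + P′(A)` and `P′(A) = B9Eq360Vprime.pPrime G′ G′(U′U) Q′* Q′*(U′U) C⁻¹ C⁻¹(U′U) Q′ Q′(U′U)`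
  (read on the sites through `rep`) has the printed kernel bounds `|P′(A)(x,x′)| ≦ Kα₁e^{−(δ₀/4)d}v(y′)⁻¹`, `|(∇_kP′(A))(x,x′)|, |(P′(A)∇*_l)(x,x′)| ≦
  Kα₁(Lʲη)⁻¹e^{−(δ₀/4)d}v⁻¹`, `|(∇_kP′(A)∇*_l)(x,x′)| ≦ Kα₁(Lʲη)⁻²e^{−(δ₀/4)d}v⁻¹`) with the quantifier order `∃ a₁ > 0 ∃ K ≧ 0 ∀ S T U g blk kQ sQ
  cfun w (axioms, [4] Lemma 2.1, scale transfer with the GIVEN Λ(·), (3.19)/(3.24)/(3.60) data, Theorem 3.1 for G′(U) = (Δ′_a(U))⁻¹ as block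
  majorants AND kernel bounds, the (3.19) letters with a section `rep`, Theorem 3.2 for U) ∀ α₁ ≦ a₁ ∀ A kF sF … ∀ (3.57)/(3.59) letters` — hypotheses
  inside the `∀` = FILE 33's (= FILE 30's) VERBATIM (named binders), less `hrepr` (moved before) and with `hST` in the uniform form; `a₁`, `K` =
  FILE 33's values read at `Λ(1/100)` with the uniform twins' thresholds/constants.
* §2 **`thm34_R_kernel_uniform`** — FILE 33 `thm34_R_kernel_final` (THE `R(U)`-CLAUSE COMPLETE IN KERNEL FORM: one `C⁻¹(U′U)` with
  `P(U′U) = P(U) + P′(A)`, the four (3.49) kernel bounds for `P(U′U)` at `K` and the four (3.68) kernel bounds for `P′(A)` at `Kα₁`, rate `δ₀/5`)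
  with the same quantifier order — FILE 51 `thm34_P_kernel_uniform` and §1 invoked before the lattice, the two `C⁻¹(U′U)` identified by uniqueness
  of the two-sided inverse.  (FILE 33's per-lattice statements follow by instantiation with `Λf := fun _ => Λ`.)

PROOF.  FILE 33's proofs verbatim after the re-ordering (scripted: `work/unif.py` + `work/gen52.py` in the seat folder): the uniform callees and
every continuity threshold/bound (`exists_threshold_of_continuousAt`, `exists_bound_of_continuousAt` for `θ₃₆₃`, `κ₃₈₅`, `κ₃₆₆`, all read at
`Λ(1/100)`) BEFORE the lattice; inside, the callees' `∀`-clauses are applied to the lattice data (`replace h := h T U blk …`), then FILE 33's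
letter bookkeeping, §2 `pPrime_five_words` and §3 `hasKernelBound_pPrime_words` of FILE 33 BY NAME.

HONEST SCOPE / NOT CLAIMED.  As FILE 33: Theorems 3.1/3.2 FOR `U` are the INPUTS — the file certifies «Thms 3.1–3.2 for U ⇒ (3.68)/(3.49) at U′U»
with the print's quantifier order, not the bounds for a general background (row heads B9.Eq3.68 / B9.Eq3.49 / B9.Thm3.4 unchanged); the letters
`∇`, `∇*` are the single-direction difference letters of (3.42)'s kernel hypotheses; the rates `δ₀/4` (§1) / `δ₀/5` (§2) vs the printed `½δ₀` and
the exponents `1/100` are ONE admissible bookkeeping of «the same bounds … with different constants» (p. 403); the uniformity displayed is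
uniformity in `(S, T, 𝔅, blk)`, `U`, the operators, the letters, the section `rep` and the kernel weights `(v, c_K)` AT FIXED input constants
`(δ₀, κ_Q, B_G, B₁, c_F, C_q, a₀, d₀, M₂, Λ(·))`, `κ`, `(𝔸, b)` — the print's «dependent on d and L only» is this composed with Theorems 3.1/3.2's
own uniformity and [4] Lemma 2.1; the Hölder sentence after (3.49) is not treated; (3.37) read blockwise.  NOT summit progress.

RELATED IN THE TREE, NOT DUPLICATED (searched 2026-08-23: `lean search 'pPrime_kernel_uniform|R_kernel_uniform' --decl` = ∅): FILE 33
`B9Thm34PPrimeKernelFinal` (`thm34_pPrime_kernel_final`/`thm34_R_kernel_final` per-lattice; §1–§3 `hasMajorantHom_word349₂`, `pPrime_five_words`,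
`hasKernelBound_pPrime_words` USED BY NAME), FILE 45 `B9Thm34SectBUniform`, FILE 49 `B9Thm34GpKernelUniform`, FILE 50 `B9Eq365RemainderKernelUniform`,
FILE 51 `B9Thm34PKernelUniform`, gen 9/10 `B9Ineq363Vprime`/`B9Ineq366Vprime`, `B9Eq360Vprime` (`pOp`, `pPrime`, `eq368`, `inv_sub_inv_of_367`),
FILE 17 `B6RandomWalkSection` — all USED BY NAME; no existing module modified.
-/

noncomputable section

namespace Literature.MathematicalPhysics.QuantumFieldTheory.Balaban1983to89.B9Thm34PPrimeKernelUniform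

open NormedSpace Complex
open Literature.MathematicalPhysics.QuantumFieldTheory.Balaban1983to89
open Literature.MathematicalPhysics.QuantumFieldTheory.Balaban1983to89.B6RandomWalk (HasMajorant hasMajorant_mono Triangle254 Ineq261)
open Literature.MathematicalPhysics.QuantumFieldTheory.Balaban1983to89.B6RandomWalkHom (HasMajorantHom hasMajorantHom_mono hasMajorantHom_iff
  hasMajorantHom_add)
open Literature.MathematicalPhysics.QuantumFieldTheory.Balaban1983to89.B6RandomWalkKernel (HasKernelBound hasKernelBound_mono hasKernelBound_add)
open Literature.MathematicalPhysics.QuantumFieldTheory.Balaban1983to89.B9Thm34Ext (toB6)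
open Literature.MathematicalPhysics.QuantumFieldTheory.Balaban1983to89.B9Ineq347 (ScaleTransfer)
open Literature.MathematicalPhysics.QuantumFieldTheory.Balaban1983to89.B9Ineq349Hom (hasMajorantHom_rate_mono hasMajorantHom_comp_decay
  hasMajorantHom_local_comp)
open Literature.MathematicalPhysics.QuantumFieldTheory.Balaban1983to89.B9Ineq366CPrime (hasMajorant_rate_mono hasMajorant_comp_decay
  hasMajorant_comp_decay_right1 cPrimeHom kappa366)
open Literature.MathematicalPhysics.QuantumFieldTheory.Balaban1983to89.B9Ineq368PPrime (hasMajorant_neg transfers_word)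
open Literature.MathematicalPhysics.QuantumFieldTheory.Balaban1983to89.B9Ineq385VG (kappa385 kappa385_nonneg)
open Literature.MathematicalPhysics.QuantumFieldTheory.Balaban1983to89.B9Ineq385Kernel (hasKernelBound_rate_mono hasKernelBound_comp_decay)
open Literature.MathematicalPhysics.QuantumFieldTheory.Balaban1983to89.B9Ineq385KernelConcrete (eq386_resolvent_of_inverses)
open Literature.MathematicalPhysics.QuantumFieldTheory.Balaban1983to89.B9Eq39Adjoint (covD covDstar)
open Literature.MathematicalPhysics.QuantumFieldTheory.Balaban1983to89.B9Eq352DivForm (tauB)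
open Literature.MathematicalPhysics.QuantumFieldTheory.Balaban1983to89.B9Eq352DivFormLetters (conj)
open Literature.MathematicalPhysics.QuantumFieldTheory.Balaban1983to89.B9Eq352GradLetters (diffLetter)
open Literature.MathematicalPhysics.QuantumFieldTheory.Balaban1983to89.B9Eq360Vprime (gPrimeExtEnd pOp pPrime eq368 pPrime_telescope
  inv_sub_inv_of_367)
open Literature.MathematicalPhysics.QuantumFieldTheory.Balaban1983to89.B9Eq360VprimeLetters (vPrimeConc cBConc)
open Literature.MathematicalPhysics.QuantumFieldTheory.Balaban1983to89.B9Ineq363Vprime (cVConc cVConc_nonneg theta363 theta363_nonneg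
  ineq363_op_vPrime)
open Literature.MathematicalPhysics.QuantumFieldTheory.Balaban1983to89.B9Ineq366Vprime (eq365b_hom hasMajorant_cPrimeHom_vPrime)
open Literature.MathematicalPhysics.QuantumFieldTheory.Balaban1983to89.B6RandomWalkSection (secExt secRes secConj secConj_def secRes_secExt_apply
  hasMajorant_id_of_ker)
open Literature.MathematicalPhysics.QuantumFieldTheory.Balaban1983to89.B9Thm34GFinal (ineq261_rescale c1_pos_of_ineq261
  exists_threshold_of_continuousAt)
open Literature.MathematicalPhysics.QuantumFieldTheory.Balaban1983to89.B9Thm34GKernelFinal (exists_bound_of_continuousAt)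
open Literature.MathematicalPhysics.QuantumFieldTheory.Balaban1983to89.B9Thm34SectBUniform (thm34_Gp_uniform thm34_Cinv_uniform)
open Literature.MathematicalPhysics.QuantumFieldTheory.Balaban1983to89.B9Thm34GpKernelUniform (thm34_Gp_kernel_uniform)
open Literature.MathematicalPhysics.QuantumFieldTheory.Balaban1983to89.B9Eq365RemainderKernelUniform (remainder365_kernel_uniform)
open Literature.MathematicalPhysics.QuantumFieldTheory.Balaban1983to89.B9Thm34PKernelUniform (thm34_P_kernel_uniform)
open Literature.MathematicalPhysics.QuantumFieldTheory.Balaban1983to89.B9Thm34PPrimeKernelFinal (hasMajorantHom_word349₂ pPrime_five_words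
  hasKernelBound_pPrime_words)

/-! ## §1  Theorem 3.4, `R(U)`-clause: (3.68) for `P′(A)` in the printed kernel form with `a₁`, `K` chosen before the lattice -/

section PPrimeU

variable {𝔸 : Type*} [NormedRing 𝔸] [NormedAlgebra ℂ 𝔸] [CompleteSpace 𝔸] {ι : Type} [Fintype ι]
variable (b : Module.Basis ι ℝ 𝔸) (κ : Type) [Fintype κ]

set_option maxHeartbeats 1600000 in
/-- **THEOREM 3.4, `R(U)`-CLAUSE: (3.68) FOR `P′(A)` IN THE PRINTED KERNEL FORM, CONSTANTS BEFORE THE LATTICE** — p. 403 «Moreover we have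
P(U′U) = P(U) + P′(A), |P′(A;x,x′)|, |(DP′(A))_μ(x,x′)|, |(P′(A)D*)_ν(x,x′)|, |(DP′(A)D*)_{μν}(x,x′)| ≦ O(1)α₁[1, (Lʲη)⁻¹, (Lʲη)⁻¹, (Lʲη)⁻²]
(L^{j′}η)^{−d}e^{−(1/2)δ₀d(y,y′)} (3.68)», p. 399 «the constants … do not depend on the sequence {Ω_j}»: for fixed `d`, `κ`, `(𝔸, b, M₂)`, input
constants `δ₀, κ_Q, B_G, B₁, c_F, C_q, a₀, d₀` and ONE scale-transfer function `Λ(·) ≧ 1`, THERE EXIST `a₁ > 0`, `K ≧ 0` such that FOR EVERY lattice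
`(S, T)`, geometry `𝔅 = g` with `blk` (axioms, [4] (2.61), scale transfer with `Λ(α)`), background `U`, (3.19)/(3.24)/(3.60) data,
`G′(U) = (Δ′_a(U))⁻¹` with Theorem 3.1 (block majorants and kernel bounds), (3.19) letters with a section `rep` and Theorem 3.2 for `U`: for all
`0 ≦ α₁ ≦ a₁`, all `A` in (3.37) (blockwise), (3.59) kernels and (3.57)/(3.59) letters, THERE EXISTS `C⁻¹(U′U)` (two-sided inverse of
`Q′(U′U)G′²(U′U)Q′*(U′U)`) such that `P(U′U) = P(U) + P′(A)` and `P′(A) = pPrime G′ G′(U′U) Q′* Q′*(U′U) C⁻¹ C⁻¹(U′U) Q′ Q′(U′U)` has the kernel bounds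
`|P′(A)(x,x′)| ≦ Kα₁e^{−(δ₀/4)d(y,y′)}v(y′)⁻¹`, `|(∇_kP′(A))(x,x′)|, |(P′(A)∇*_l)(x,x′)| ≦ Kα₁(Lʲη)⁻¹e^{−(δ₀/4)d}v(y′)⁻¹`, `|(∇_kP′(A)∇*_l)(x,x′)| ≦
Kα₁(Lʲη)⁻²e^{−(δ₀/4)d}v(y′)⁻¹` — FILE 33 `thm34_pPrime_kernel_final` verbatim, re-quantified.
[cite: Balaban1985BackgroundPropagators, Thm 3.4 p.400 + (3.68) p.403 + p.399 + (3.49) p.399 + (3.25) p.394 + Thm 3.1 (3.42) p.397 + Thm 3.2 (3.48) p.398 + p.398 remark + (3.19)/(3.21) pp.393–394 + (3.57) p.401 + (3.59)–(3.67) pp.402–403 + (3.37) p.396; Balaban1984PropagatorsII, Lemma 2.1 p.234 + (2.51)–(2.55) p.232 + (2.66) p.234 + (2.68) p.235] -/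
theorem thm34_pPrime_kernel_uniform [DecidableEq ι] (d : ℕ)
    (δ₀ κQ BG B₁ cF Cq a₀ d₀ M₂ : ℝ) (Λf : ℝ → ℝ)
    (hκQ : 0 < κQ) (hBG : 0 < BG) (hB₁ : 0 < B₁) (hcF : 0 < cF) (hCq : 0 ≤ Cq) (ha₀ : 0 ≤ a₀) (hM₂ : 0 ≤ M₂) (hδ₀ : 0 < δ₀) (hΛf : ∀ α : ℝ, 0 < α → 1 ≤ Λf α)
    (hrepr : ∀ (v : 𝔸) (i : ι), |b.repr v i| ≤ M₂ * ‖v‖) :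
    ∃ a₁ : ℝ, 0 < a₁ ∧ ∃ K : ℝ, 0 ≤ K ∧
    ∀ {S : Type} [Fintype S] [DecidableEq S] (T : κ → Equiv.Perm S) (U : κ → S → 𝔸ˣ)
      {g : B9.Geometry} [Fintype g.Site] [DecidableEq g.Site] [Nonempty g.Site] {Rr : ℝ} {H : Prop} (blk : S → g.Site)
      (kQ : g.Site → S → 𝔸 →L[ℝ] 𝔸) (sQ : S → 𝔸 →L[ℝ] 𝔸) (cfun w : g.Site → ℝ)
    -- the multiscale geometry 𝔅 and its axioms
    (hdnn : ∀ a a' : g.Site, 0 ≤ g.dist a a') (htri : Triangle254 (toB6 g Rr H)) (hrefl : ∀ y : g.Site, g.dist y y = 0)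
    (hsym : ∀ y y' : g.Site, g.dist y y' = g.dist y' y) (hlen : ∀ y : g.Site, 0 < g.len y) (hlenη : ∀ y : g.Site, g.eta ≤ g.len y)
    (hη : 0 < g.eta)
    -- [4] Lemma 2.1 (2.61) at the rate `δ₀`, «for every 0 < α < 1», and the p. 398 scale transfer for every exponent
    (h261 : ∀ α : ℝ, 0 < α → α < 1 → Ineq261 d (toB6 g Rr H) δ₀ α)
      (hST : ∀ α : ℝ, 0 < α → ScaleTransfer g δ₀ α (Λf α) (fun a => g.len a) ∧ ScaleTransfer g δ₀ α (Λf α) (fun a => g.len a ^ 2) ∧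
        ScaleTransfer g δ₀ α (Λf α) (fun a => (g.len a)⁻¹) ∧ ScaleTransfer g δ₀ α (Λf α) (fun a => (g.len a ^ 2)⁻¹) ∧
        ScaleTransfer g δ₀ α (Λf α) (fun a => (g.len a ^ 4)⁻¹) ∧ ScaleTransfer g δ₀ α (Λf α) (fun y => g.len y ^ (-(4 : ℝ))))
    (hU1 : ∀ m z, ‖((U m z : 𝔸ˣ) : 𝔸)‖ ≤ 1 ∧ ‖(((U m z)⁻¹ : 𝔸ˣ) : 𝔸)‖ ≤ 1)
    (hd₀B : ∀ μ x, g.dist (blk x) (blk ((T μ).symm x)) ≤ d₀) (hd₀F : ∀ μ x, g.dist (blk x) (blk (T μ x)) ≤ d₀)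
    (hd₀0 : ∀ y : g.Site, g.dist y y ≤ d₀)
    -- the `A`-independent data of the concrete `V′(A)` of (3.60)
    (hw : ∀ y, 0 ≤ w y) (hcard : ∀ y, ((B9Eq360Vprime.block blk y).card : ℝ) * w y ≤ 1)
    (hkQ : ∀ y x, blk x = y → ‖kQ y x‖ ≤ w y) (hsQ : ∀ x, ‖sQ x‖ ≤ 1) (hcfun : ∀ y, |cfun y| ≤ a₀ * (g.len y ^ 2)⁻¹)
    -- THEOREM 3.1 for `G′(U)`: (3.42)₁,₂,₃ at the rate `δ₀`
    {Gp : Module.End ℝ (S × ι → ℝ)}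
    (h342_1 : HasMajorant (g := toB6 g Rr H) (fun p : S × ι => blk p.1) Gp
      (fun a a' => BG * g.len a ^ 2 * Real.exp (-(δ₀ * g.dist a a'))))
    (h342_2 : ∀ k : κ ⊕ κ, HasMajorant (g := toB6 g Rr H) (fun p : S × ι => blk p.1)
      (conj b (diffLetter T U ((g.eta : ℂ)⁻¹) k) * Gp) (fun a a' => BG * g.len a * Real.exp (-(δ₀ * g.dist a a'))))
    (h342_3 : ∀ k : κ ⊕ κ, HasMajorant (g := toB6 g Rr H) (fun p : S × ι => blk p.1)
      (Gp * conj b (diffLetter T U ((g.eta : ℂ)⁻¹) k)) (fun a a' => BG * g.len a * Real.exp (-(δ₀ * g.dist a a'))))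
    -- the (3.19) letters `Q′(U)`, `Q′*(U)` in their own typing with block-local two-space majorants, a section of the block map (FILE 17)
    (rep : g.Site → S × ι) (hrep : ∀ y : g.Site, blk (rep y).1 = y)
    {Qc : (S × ι → ℝ) →ₗ[ℝ] (g.Site → ℝ)} {Qcs : (g.Site → ℝ) →ₗ[ℝ] (S × ι → ℝ)} {Linv : Module.End ℝ (g.Site → ℝ)}
    (hQc : HasMajorantHom (g := toB6 g Rr H) (fun p : S × ι => blk p.1) (fun y : g.Site => y) Qc
      (fun a a' : g.Site => κQ * (if a = a' then (1 : ℝ) else 0)))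
    (hQcs : HasMajorantHom (g := toB6 g Rr H) (fun y : g.Site => y) (fun p : S × ι => blk p.1) Qcs
      (fun a a' : g.Site => κQ * (if a = a' then (1 : ℝ) else 0)))
    -- THEOREM 3.2 for `U`: (3.21) `C⁻¹ = (Q′G′²Q′*)⁻¹` exists (`hLinv`) with the KERNEL bound (3.48) at the rate `δ₀`
    (hLinv : (Qc ∘ₗ (Gp * Gp) ∘ₗ Qcs) * Linv = 1)
    (h348 : ∀ y y' : g.Site, |B9Thm34Inv.ker (B9Thm34Inv.vol g d) Linv y y'| ≤
      B₁ * g.len y ^ (-(4 : ℝ)) * g.len y' ^ (-(d : ℝ)) * Real.exp (-(δ₀ * g.dist y y')))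
    -- THEOREM 3.1 for `G′(U)`: the letter `Δ′_a(U)` with `G′(U)` its two-sided inverse ((3.26); FILE 26)
    {Δp : Module.End ℝ (S × ι → ℝ)} (hΔpGp : Δp * Gp = 1) (hGpΔp : Gp * Δp = 1)
    -- the kernel pairing of p. 393 (`c = η^d`, block volume weight `v(y′) = (L^{j′}η)^d`) and THEOREM 3.1's (3.42)₁₋₄ FOR `G′(U)` IN THE PRINTED KERNEL FORM
    {v : g.Site → ℝ} (hv : ∀ y, 0 < v y) {cK : ℝ} (hcK : 0 < cK)
    (hGpk : HasKernelBound (g := toB6 g Rr H) (fun p : S × ι => blk p.1) v cK Gp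
      (fun a a' => BG * g.len a ^ 2 * Real.exp (-(δ₀ * g.dist a a'))))
    (hDGpk : ∀ k : κ ⊕ κ, HasKernelBound (g := toB6 g Rr H) (fun p : S × ι => blk p.1) v cK
      (conj b (diffLetter T U ((g.eta : ℂ)⁻¹) k) * Gp) (fun a a' => BG * g.len a * Real.exp (-(δ₀ * g.dist a a'))))
    (hGpDk : ∀ l : κ ⊕ κ, HasKernelBound (g := toB6 g Rr H) (fun p : S × ι => blk p.1) v cK
      (Gp * conj b (diffLetter T U ((g.eta : ℂ)⁻¹) l)) (fun a a' => BG * g.len a * Real.exp (-(δ₀ * g.dist a a'))))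
    (hDGpDk : ∀ k l : κ ⊕ κ, HasKernelBound (g := toB6 g Rr H) (fun p : S × ι => blk p.1) v cK
      (conj b (diffLetter T U ((g.eta : ℂ)⁻¹) k) * Gp * conj b (diffLetter T U ((g.eta : ℂ)⁻¹) l)) (fun a a' => BG * Real.exp (-(δ₀ * g.dist a a')))),
    ∀ (α₁ : ℝ), 0 ≤ α₁ → α₁ ≤ a₁ →
    -- the exponent field `A` in the domain (3.37), read blockwise, and the `A`-dependent (3.59) data `kF`, `sF`
    ∀ (A : κ → S → 𝔸) (kF : g.Site → S → 𝔸 →L[ℝ] 𝔸) (sF : S → 𝔸 →L[ℝ] 𝔸),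
      (∀ y x, blk x = y → ‖kF y x‖ ≤ Cq * α₁ * w y) → (∀ x, ‖sF x‖ ≤ Cq * α₁) →
      (∀ ν k x, ‖((g.eta : ℂ)⁻¹) • covDstar T U ν (A k) x‖ ≤ α₁ * (g.len (blk x) ^ 2)⁻¹) →
      (∀ μ ν x, ‖((g.eta : ℂ)⁻¹) • covD T U μ (A ν) x‖ ≤ α₁ * (g.len (blk x) ^ 2)⁻¹) →
      (∀ μ x, ‖((g.eta : ℂ)⁻¹) • covDstar T U μ (tauB T U μ (A μ)) x‖ ≤ α₁ * (g.len (blk x) ^ 2)⁻¹) →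
      (∀ k x, ‖A k x‖ ≤ α₁ * (g.len (blk x))⁻¹) → (∀ ν k x, ‖tauB T U ν (A k) x‖ ≤ α₁ * (g.len (blk x))⁻¹) →
    -- the (3.57)/(3.59) letters `F′₂(A)`, `F′₂*(A)` (block-local, size `c_F α₁`)
    ∀ {Qc' Fc : (S × ι → ℝ) →ₗ[ℝ] (g.Site → ℝ)} {Qcs' Fcs : (g.Site → ℝ) →ₗ[ℝ] (S × ι → ℝ)},
      Qc' = Qc + Fc → Qcs' = Qcs + Fcs →
      HasMajorantHom (g := toB6 g Rr H) (fun p : S × ι => blk p.1) (fun y : g.Site => y) Fc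
        (fun a a' : g.Site => cF * α₁ * (if a = a' then (1 : ℝ) else 0)) →
      HasMajorantHom (g := toB6 g Rr H) (fun y : g.Site => y) (fun p : S × ι => blk p.1) Fcs
        (fun a a' : g.Site => cF * α₁ * (if a = a' then (1 : ℝ) else 0)) →
    ∃ Tinv : Module.End ℝ (g.Site → ℝ),
      Tinv * (Qc' ∘ₗ ((gPrimeExtEnd Gp (conj b (vPrimeConc T U g.eta A blk kQ kF sQ sF cfun) * Gp)) * (gPrimeExtEnd Gp (conj b (vPrimeConc T U g.eta A blk kQ kF sQ sF cfun) * Gp))) ∘ₗ Qcs') = 1 ∧ (Qc' ∘ₗ ((gPrimeExtEnd Gp (conj b (vPrimeConc T U g.eta A blk kQ kF sQ sF cfun) * Gp)) * (gPrimeExtEnd Gp (conj b (vPrimeConc T U g.eta A blk kQ kF sQ sF cfun) * Gp))) ∘ₗ Qcs') * Tinv = 1 ∧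
      -- (3.68), first line: `P(U′U) = P(U) + P′(A)` (letters read on the sites through the section `rep`)
      pOp (gPrimeExtEnd Gp (conj b (vPrimeConc T U g.eta A blk kQ kF sQ sF cfun) * Gp)) (Qcs' ∘ₗ secRes rep) (secConj rep Tinv) (secExt rep ∘ₗ Qc') =
        pOp Gp (Qcs ∘ₗ secRes rep) (secConj rep Linv) (secExt rep ∘ₗ Qc) + pPrime Gp (gPrimeExtEnd Gp (conj b (vPrimeConc T U g.eta A blk kQ kF sQ sF cfun) * Gp)) (Qcs ∘ₗ secRes rep) (Qcs' ∘ₗ secRes rep) (secConj rep Linv) (secConj rep Tinv) (secExt rep ∘ₗ Qc) (secExt rep ∘ₗ Qc') ∧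
      -- (3.68): the four entries of `P′(A)` in the printed kernel form, with the factor `α₁`
      HasKernelBound (g := toB6 g Rr H) (fun p : S × ι => blk p.1) v cK (pPrime Gp (gPrimeExtEnd Gp (conj b (vPrimeConc T U g.eta A blk kQ kF sQ sF cfun) * Gp)) (Qcs ∘ₗ secRes rep) (Qcs' ∘ₗ secRes rep) (secConj rep Linv) (secConj rep Tinv) (secExt rep ∘ₗ Qc) (secExt rep ∘ₗ Qc'))
        (fun a a' => K * α₁ * Real.exp (-(1 / 4 * δ₀ * g.dist a a'))) ∧
      (∀ k : κ ⊕ κ, HasKernelBound (g := toB6 g Rr H) (fun p : S × ι => blk p.1) v cK (conj b (diffLetter T U ((g.eta : ℂ)⁻¹) k) * pPrime Gp (gPrimeExtEnd Gp (conj b (vPrimeConc T U g.eta A blk kQ kF sQ sF cfun) * Gp)) (Qcs ∘ₗ secRes rep) (Qcs' ∘ₗ secRes rep) (secConj rep Linv) (secConj rep Tinv) (secExt rep ∘ₗ Qc) (secExt rep ∘ₗ Qc'))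
        (fun a a' => K * α₁ * (g.len a)⁻¹ * Real.exp (-(1 / 4 * δ₀ * g.dist a a')))) ∧
      (∀ l : κ ⊕ κ, HasKernelBound (g := toB6 g Rr H) (fun p : S × ι => blk p.1) v cK (pPrime Gp (gPrimeExtEnd Gp (conj b (vPrimeConc T U g.eta A blk kQ kF sQ sF cfun) * Gp)) (Qcs ∘ₗ secRes rep) (Qcs' ∘ₗ secRes rep) (secConj rep Linv) (secConj rep Tinv) (secExt rep ∘ₗ Qc) (secExt rep ∘ₗ Qc') * conj b (diffLetter T U ((g.eta : ℂ)⁻¹) l))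
        (fun a a' => K * α₁ * (g.len a)⁻¹ * Real.exp (-(1 / 4 * δ₀ * g.dist a a')))) ∧
      (∀ k l : κ ⊕ κ, HasKernelBound (g := toB6 g Rr H) (fun p : S × ι => blk p.1) v cK (conj b (diffLetter T U ((g.eta : ℂ)⁻¹) k) * pPrime Gp (gPrimeExtEnd Gp (conj b (vPrimeConc T U g.eta A blk kQ kF sQ sF cfun) * Gp)) (Qcs ∘ₗ secRes rep) (Qcs' ∘ₗ secRes rep) (secConj rep Linv) (secConj rep Tinv) (secExt rep ∘ₗ Qc) (secExt rep ∘ₗ Qc') * conj b (diffLetter T U ((g.eta : ℂ)⁻¹) l))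
        (fun a a' => K * α₁ * (g.len a ^ 2)⁻¹ * Real.exp (-(1 / 4 * δ₀ * g.dist a a')))) := by
  classical
  -- the scale-transfer constant of the chain, READ FROM THE GIVEN FUNCTION `Λf` (lattice-free)
  have hΛ1 : 1 ≤ Λf (1 / 100) := hΛf _ (by norm_num)
  have hΛ0 : 0 ≤ Λf (1 / 100) := zero_le_one.trans hΛ1
  -- FILE 45 (`G′(U′U)` left entries; `C⁻¹(U′U)` with (3.48)), FILE 49 (`G′(U′U)·Y` in kernel form), FILE 50 (`(G′(U′U) − G′(U))·Y` in kernel form) — the uniform twins, BEFORE THE LATTICE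
  obtain ⟨a₁, ha₁, B, hB, hGp⟩ := thm34_Gp_uniform b κ d δ₀ BG Cq a₀ d₀ M₂ Λf hBG hCq ha₀ hM₂ hδ₀ hΛf hrepr
  obtain ⟨a₂, ha₂, B', hB', hGpK⟩ := thm34_Gp_kernel_uniform b κ d δ₀ BG Cq a₀ d₀ M₂ Λf hBG hCq ha₀ hM₂ hδ₀ hΛf hrepr
  obtain ⟨a₃, ha₃, hCi⟩ := thm34_Cinv_uniform b κ d δ₀ κQ BG B₁ cF Cq a₀ d₀ M₂ Λf hκQ hBG hB₁ hcF hCq ha₀ hM₂ hδ₀ hΛf hrepr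
  obtain ⟨a₄, ha₄, B₄, hB₄, hRem⟩ := remainder365_kernel_uniform b κ d δ₀ BG Cq a₀ d₀ M₂ Λf hBG hCq ha₀ hM₂ hδ₀ hΛf hrepr
  have hc1 : 0 ≤ B6.c1 d δ₀ (1 / 100) := B6RandomWalk.c1_nonneg d δ₀ (1 / 100)
  have hcT : 0 ≤ B6.c1 d (2 / 5 * δ₀) (1 / 10) := B6RandomWalk.c1_nonneg d (2 / 5 * δ₀) (1 / 10)
  -- «for α₁ sufficiently small» / «of course with different constants» (pp. 402–403): one threshold and two bounds by continuity at `α₁ = 0`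
  obtain ⟨ε₁, hε₁, hF1⟩ := exists_threshold_of_continuousAt
    (f := fun α₁ : ℝ => theta363 (Fintype.card κ) 1 α₁ a₀ Cq M₂ (∑ i, ‖b i‖) (Real.exp (δ₀ * d₀)) BG (Λf (1 / 100)) (B6.c1 d δ₀ (1 / 100)) * B6.c1 d (49 / 50 * δ₀) (1 / 100))
    (by unfold theta363 kappa385 cVConc cBConc; fun_prop) (by simp [theta363])
  obtain ⟨K₁, ε₂, hK₁, hε₂, hK₁b⟩ := exists_bound_of_continuousAt
    (f := fun α₁ : ℝ => kappa385 BG (cVConc (Fintype.card κ) 1 α₁ a₀ Cq M₂ (∑ i, ‖b i‖) (Real.exp (δ₀ * d₀))) 0 0 (Λf (1 / 100)) (B6.c1 d δ₀ (1 / 100)))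
    (by unfold kappa385 cVConc cBConc; fun_prop)
  obtain ⟨K₆, ε₃, hK₆, hε₃, hK₆b⟩ := exists_bound_of_continuousAt
    (f := fun α₁ : ℝ => kappa366 κQ cF (kappa385 1 (cVConc (Fintype.card κ) 1 α₁ a₀ Cq M₂ (∑ i, ‖b i‖) (Real.exp (δ₀ * d₀))) 0 0 (Λf (1 / 100)) (B6.c1 d δ₀ (1 / 100))) BG (BG * B6.c1 d (49 / 50 * δ₀) (1 / 100) * (1 - theta363 (Fintype.card κ) 1 α₁ a₀ Cq M₂ (∑ i, ‖b i‖) (Real.exp (δ₀ * d₀)) BG (Λf (1 / 100)) (B6.c1 d δ₀ (1 / 100)) * B6.c1 d (49 / 50 * δ₀) (1 / 100))⁻¹) (Λf (1 / 100)) (B6.c1 d δ₀ (1 / 100)) α₁)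
    (by
      unfold theta363 kappa366 kappa385 cVConc cBConc
      fun_prop (disch := simp))
  -- the `α₁`-free constants of the five words: `B_Xd = B K₁ c₁`, `B_T = 2B₁c₁(2δ₀/5,1/10)`, `B_TL`, and the final `K`
  have hBXd0 : 0 ≤ B * K₁ * B6.c1 d δ₀ (1 / 100) := mul_nonneg (mul_nonneg hB hK₁) hc1
  have hBT0 : 0 ≤ 2 * B₁ * B6.c1 d (2 / 5 * δ₀) (1 / 10) := mul_nonneg (mul_nonneg zero_le_two hB₁.le) hcT
  have hBTL0 : 0 ≤ 2 * B₁ * B6.c1 d (2 / 5 * δ₀) (1 / 10) * K₆ * B₁ * (Λf (1 / 100)) * B6.c1 d δ₀ (1 / 100) * (Λf (1 / 100)) * B6.c1 d δ₀ (1 / 100) := by positivity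
  have hκ' : 0 ≤ κQ + cF := add_nonneg hκQ.le hcF.le
  have hK : 0 ≤ (((κQ + cF) * (κQ + cF) * (B * K₁ * B6.c1 d δ₀ (1 / 100)) * (2 * B₁ * B6.c1 d (2 / 5 * δ₀) (1 / 10)) + cF * (κQ + cF) * BG * (2 * B₁ * B6.c1 d (2 / 5 * δ₀) (1 / 10)) + (κQ + cF) * (κQ + cF) * BG * (2 * B₁ * B6.c1 d (2 / 5 * δ₀) (1 / 10) * K₆ * B₁ * (Λf (1 / 100)) * B6.c1 d δ₀ (1 / 100) * (Λf (1 / 100)) * B6.c1 d δ₀ (1 / 100)) + (κQ + cF) * cF * BG * B₁) * B' + (κQ + cF) * (κQ + cF) * BG * B₁ * B₄) * (Λf (1 / 100)) ^ 4 * B6.c1 d δ₀ (1 / 100) ^ 2 * (Λf (1 / 100)) * B6.c1 d δ₀ (1 / 100) := by positivity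
  refine ⟨min (min (min a₁ a₂) (min a₃ a₄)) (min (min (ε₁ / 2) (ε₂ / 2)) (min (ε₃ / 2) (1 / 4))),
    lt_min (lt_min (lt_min ha₁ ha₂) (lt_min ha₃ ha₄)) (lt_min (lt_min (half_pos hε₁) (half_pos hε₂)) (lt_min (half_pos hε₃) (by norm_num))),
    (((κQ + cF) * (κQ + cF) * (B * K₁ * B6.c1 d δ₀ (1 / 100)) * (2 * B₁ * B6.c1 d (2 / 5 * δ₀) (1 / 10)) + cF * (κQ + cF) * BG * (2 * B₁ * B6.c1 d (2 / 5 * δ₀) (1 / 10)) + (κQ + cF) * (κQ + cF) * BG * (2 * B₁ * B6.c1 d (2 / 5 * δ₀) (1 / 10) * K₆ * B₁ * (Λf (1 / 100)) * B6.c1 d δ₀ (1 / 100) * (Λf (1 / 100)) * B6.c1 d δ₀ (1 / 100)) + (κQ + cF) * cF * BG * B₁) * B' + (κQ + cF) * (κQ + cF) * BG * B₁ * B₄) * (Λf (1 / 100)) ^ 4 * B6.c1 d δ₀ (1 / 100) ^ 2 * (Λf (1 / 100)) * B6.c1 d δ₀ (1 / 100), hK, ?_⟩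
  -- NOW the lattice, the background, the data, the Theorems-for-`U` inputs (block and kernel members); then `α₁`, `A` and the `A`-letters
  intro S _ _ T U g _ _ _ Rr H blk kQ sQ cfun w hdnn htri hrefl hsym hlen hlenη hη h261 hST hU1 hd₀B hd₀F hd₀0 hw hcard hkQ hsQ hcfun Gp h342_1
    h342_2 h342_3 rep hrep Qc Qcs Linv hQc hQcs hLinv h348 Δp hΔpGp hGpΔp v hv cK hcK hGpk hDGpk hGpDk hDGpDk α₁ hα₁0 hα₁1 A kF sF hkF hsF h337B
    h337F h337Bτ hA hAτB Qc' Fc Qcs' Fcs h357 h357s hFc hFcs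
  obtain ⟨y₀⟩ := ‹Nonempty g.Site›
  replace hGp := hGp T U blk kQ sQ cfun w hdnn htri hrefl hsym hlen hlenη hη h261 hST hU1 hd₀B hd₀F hd₀0 hw hcard hkQ hsQ hcfun hΔpGp hGpΔp h342_1
    h342_2 h342_3
  replace hGpK := hGpK T U blk kQ sQ cfun w hdnn htri hrefl hsym hlen hlenη hη h261 hST hU1 hd₀B hd₀F hd₀0 hw hcard hkQ hsQ hcfun hΔpGp hGpΔp h342_1
    h342_2 h342_3 hv hcK hGpk hDGpk hGpDk hDGpDk
  replace hCi := hCi T U blk kQ sQ cfun w hdnn htri hrefl hsym hlen hlenη hη h261 hST hU1 hd₀B hd₀F hd₀0 hw hcard hkQ hsQ hcfun h342_1 h342_2 hQc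
    hQcs hLinv h348
  replace hRem := hRem T U blk kQ sQ cfun w hdnn htri hrefl hsym hlen hlenη hη h261 hST hU1 hd₀B hd₀F hd₀0 hw hcard hkQ hsQ hcfun hΔpGp hGpΔp h342_1
    h342_2 h342_3 hv hcK hGpk hDGpk hGpDk hDGpDk
  -- the p. 398 scale transfers and [4] Lemma 2.1 at exponent `1/100` (and at the rate `49δ₀/50` for (3.66))
  obtain ⟨hT1, hT2, -, -, hT4, -⟩ := hST (1 / 100) (by norm_num)
  have h261β : Ineq261 d (toB6 g Rr H) δ₀ (1 / 100) := h261 _ (by norm_num) (by norm_num)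
  have h261c : Ineq261 d (toB6 g Rr H) (49 / 50 * δ₀) (1 / 100) :=
    ineq261_rescale (h261 (1 / 100 * (49 / 50)) (by norm_num) (by norm_num))
  have hcc' : 0 < B6.c1 d (49 / 50 * δ₀) (1 / 100) := c1_pos_of_ineq261 h261c y₀ (hrefl y₀)
  have hm1 : min (min (min a₁ a₂) (min a₃ a₄)) (min (min (ε₁ / 2) (ε₂ / 2)) (min (ε₃ / 2) (1 / 4))) ≤ min (min a₁ a₂) (min a₃ a₄) := min_le_left _ _
  have hm2 : min (min (min a₁ a₂) (min a₃ a₄)) (min (min (ε₁ / 2) (ε₂ / 2)) (min (ε₃ / 2) (1 / 4))) ≤ min (min (ε₁ / 2) (ε₂ / 2)) (min (ε₃ / 2) (1 / 4)) :=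
    min_le_right _ _
  have hα₁a : α₁ ≤ a₁ := hα₁1.trans (hm1.trans ((min_le_left _ _).trans (min_le_left _ _)))
  have hα₁b : α₁ ≤ a₂ := hα₁1.trans (hm1.trans ((min_le_left _ _).trans (min_le_right _ _)))
  have hα₁c : α₁ ≤ a₃ := hα₁1.trans (hm1.trans ((min_le_right _ _).trans (min_le_left _ _)))
  have hα₁d : α₁ ≤ a₄ := hα₁1.trans (hm1.trans ((min_le_right _ _).trans (min_le_right _ _)))
  have hα₁ε₁ : α₁ ≤ ε₁ / 2 := hα₁1.trans (hm2.trans ((min_le_left _ _).trans (min_le_left _ _)))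
  have hα₁ε₂ : α₁ ≤ ε₂ / 2 := hα₁1.trans (hm2.trans ((min_le_left _ _).trans (min_le_right _ _)))
  have hα₁ε₃ : α₁ ≤ ε₃ / 2 := hα₁1.trans (hm2.trans ((min_le_right _ _).trans (min_le_left _ _)))
  have hα₁q : α₁ ≤ 1 / 4 := hα₁1.trans (hm2.trans ((min_le_right _ _).trans (min_le_right _ _)))
  have hα₁one : α₁ ≤ 1 := by linarith
  have habs : |α₁| = α₁ := abs_of_nonneg hα₁0
  -- the four inputs at this `α₁`, `A`
  obtain ⟨i1, i2, hL, -⟩ := hGp α₁ hα₁0 hα₁a A kF sF hkF hsF h337B h337F h337Bτ hA hAτB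
  obtain ⟨-, -, hKE, -, hKED, -⟩ := hGpK α₁ hα₁0 hα₁b A kF sF hkF hsF h337B h337F h337Bτ hA hAτB
  obtain ⟨Tinv, hTl, hTr, h348T⟩ := hCi α₁ hα₁0 hα₁c A kF sF hkF hsF h337B hA hAτB h357 h357s hFc hFcs
  obtain ⟨-, -, hRk, -, hRkD, -⟩ := hRem α₁ hα₁0 hα₁d A kF sF hkF hsF h337B h337F h337Bτ hA hAτB
  -- the threshold and the two bounds at this `α₁`
  have h1 : theta363 (Fintype.card κ) 1 α₁ a₀ Cq M₂ (∑ i, ‖b i‖) (Real.exp (δ₀ * d₀)) BG (Λf (1 / 100)) (B6.c1 d δ₀ (1 / 100)) * B6.c1 d (49 / 50 * δ₀) (1 / 100) < 1 / 2 :=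
    hF1 α₁ (by rw [habs]; linarith)
  have hhalf : (1 / 2 : ℝ) < 1 := by norm_num
  have hK₁α : kappa385 BG (cVConc (Fintype.card κ) 1 α₁ a₀ Cq M₂ (∑ i, ‖b i‖) (Real.exp (δ₀ * d₀))) 0 0 (Λf (1 / 100)) (B6.c1 d δ₀ (1 / 100)) ≤ K₁ :=
    hK₁b α₁ (by rw [habs]; linarith)
  have hK₆α : kappa366 κQ cF (kappa385 1 (cVConc (Fintype.card κ) 1 α₁ a₀ Cq M₂ (∑ i, ‖b i‖) (Real.exp (δ₀ * d₀))) 0 0 (Λf (1 / 100)) (B6.c1 d δ₀ (1 / 100))) BG (BG * B6.c1 d (49 / 50 * δ₀) (1 / 100) * (1 - theta363 (Fintype.card κ) 1 α₁ a₀ Cq M₂ (∑ i, ‖b i‖) (Real.exp (δ₀ * d₀)) BG (Λf (1 / 100)) (B6.c1 d δ₀ (1 / 100)) * B6.c1 d (49 / 50 * δ₀) (1 / 100))⁻¹) (Λf (1 / 100)) (B6.c1 d δ₀ (1 / 100)) α₁ ≤ K₆ :=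
    hK₆b α₁ (by rw [habs]; linarith)
  refine ⟨Tinv, hTl, hTr, eq368 _ _ _ _ _ _ _ _, ?_⟩
  -- the shapes in which gen 9/10 read (3.37), the transports and the stencil geometry
  have hsmall : ∀ y : g.Site, g.eta * (α₁ * (g.len y)⁻¹) ≤ 1 / 4 := fun y => by
    have hq : g.eta * (g.len y)⁻¹ ≤ 1 := by
      rw [← div_eq_mul_inv]; exact (div_le_one (hlen y)).mpr (hlenη y)
    calc g.eta * (α₁ * (g.len y)⁻¹) = α₁ * (g.eta * (g.len y)⁻¹) := by ring
      _ ≤ α₁ * 1 := mul_le_mul_of_nonneg_left hq hα₁0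
      _ ≤ 1 / 4 := by linarith
  have hA' : ∀ μ x, ‖A μ x‖ ≤ α₁ * (g.len (blk x))⁻¹ ∧ ‖tauB T U μ (A μ) x‖ ≤ α₁ * (g.len (blk x))⁻¹ :=
    fun μ x => ⟨hA μ x, hAτB μ μ x⟩
  have h337s' : ∀ μ x, ‖((g.eta : ℂ)⁻¹) • covDstar T U μ (A μ) x‖ ≤ α₁ * (g.len (blk x) ^ 2)⁻¹ := fun μ x => h337B μ μ x
  have hd₀' : ∀ μ x, g.dist (blk x) (blk (T μ x)) ≤ d₀ ∧ g.dist (blk x) (blk ((T μ).symm x)) ≤ d₀ :=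
    fun μ x => ⟨hd₀F μ x, hd₀B μ x⟩
  have hinj : Function.Injective rep := fun y₁ y₂ h => by rw [← hrep y₁, ← hrep y₂, h]
  -- (3.65) in both resolvent forms, from the inverse identities of FILE 26 and `Δ′_a(U)G′(U) = G′(U)Δ′_a(U) = 1`
  have h365 : gPrimeExtEnd Gp (conj b (vPrimeConc T U g.eta A blk kQ kF sQ sF cfun) * Gp) = Gp + (gPrimeExtEnd Gp (conj b (vPrimeConc T U g.eta A blk kQ kF sQ sF cfun) * Gp)) * (conj b (vPrimeConc T U g.eta A blk kQ kF sQ sF cfun) * Gp) :=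
    eq386_resolvent_of_inverses (Δ := Δp) (Δ' := Δp - conj b (vPrimeConc T U g.eta A blk kQ kF sQ sF cfun)) (V := conj b (vPrimeConc T U g.eta A blk kQ kF sQ sF cfun)) hΔpGp i2 rfl
  have h365r : gPrimeExtEnd Gp (conj b (vPrimeConc T U g.eta A blk kQ kF sQ sF cfun) * Gp) = Gp + (gPrimeExtEnd Gp (conj b (vPrimeConc T U g.eta A blk kQ kF sQ sF cfun) * Gp)) * conj b (vPrimeConc T U g.eta A blk kQ kF sQ sF cfun) * Gp := by
    rw [mul_assoc]; exact h365
  have hR : (gPrimeExtEnd Gp (conj b (vPrimeConc T U g.eta A blk kQ kF sQ sF cfun) * Gp)) * (conj b (vPrimeConc T U g.eta A blk kQ kF sQ sF cfun) * Gp) = gPrimeExtEnd Gp (conj b (vPrimeConc T U g.eta A blk kQ kF sQ sF cfun) * Gp) - Gp := by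
    rw [eq_sub_iff_add_eq]; exact (add_comm _ _).trans h365.symm
  have h365l : gPrimeExtEnd Gp (conj b (vPrimeConc T U g.eta A blk kQ kF sQ sF cfun) * Gp) = Gp + Gp * conj b (vPrimeConc T U g.eta A blk kQ kF sQ sF cfun) * (gPrimeExtEnd Gp (conj b (vPrimeConc T U g.eta A blk kQ kF sQ sF cfun) * Gp)) := by
    have h1 : Gp * ((Δp - conj b (vPrimeConc T U g.eta A blk kQ kF sQ sF cfun)) * (gPrimeExtEnd Gp (conj b (vPrimeConc T U g.eta A blk kQ kF sQ sF cfun) * Gp))) = Gp := by rw [i1, mul_one]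
    rw [sub_mul, mul_sub, ← mul_assoc Gp Δp, hGpΔp, one_mul] at h1
    calc gPrimeExtEnd Gp (conj b (vPrimeConc T U g.eta A blk kQ kF sQ sF cfun) * Gp) = (gPrimeExtEnd Gp (conj b (vPrimeConc T U g.eta A blk kQ kF sQ sF cfun) * Gp) - Gp * (conj b (vPrimeConc T U g.eta A blk kQ kF sQ sF cfun) * (gPrimeExtEnd Gp (conj b (vPrimeConc T U g.eta A blk kQ kF sQ sF cfun) * Gp)))) + Gp * (conj b (vPrimeConc T U g.eta A blk kQ kF sQ sF cfun) * (gPrimeExtEnd Gp (conj b (vPrimeConc T U g.eta A blk kQ kF sQ sF cfun) * Gp))) := (sub_add_cancel _ _).symm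
      _ = Gp + Gp * conj b (vPrimeConc T U g.eta A blk kQ kF sQ sF cfun) * (gPrimeExtEnd Gp (conj b (vPrimeConc T U g.eta A blk kQ kF sQ sF cfun) * Gp)) := by rw [h1, mul_assoc]
  -- the operator identities `X·(G′(U′U) − G′(U)) = (X·G′(U′U))·(V′(A)G′(U))`
  have hop1 : (1 : Module.End ℝ (S × ι → ℝ)) * (gPrimeExtEnd Gp (conj b (vPrimeConc T U g.eta A blk kQ kF sQ sF cfun) * Gp) - Gp) = (gPrimeExtEnd Gp (conj b (vPrimeConc T U g.eta A blk kQ kF sQ sF cfun) * Gp)) * (conj b (vPrimeConc T U g.eta A blk kQ kF sQ sF cfun) * Gp) := by rw [one_mul, hR]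
  have hopk : ∀ k : κ ⊕ κ, conj b (diffLetter T U ((g.eta : ℂ)⁻¹) k) * (gPrimeExtEnd Gp (conj b (vPrimeConc T U g.eta A blk kQ kF sQ sF cfun) * Gp) - Gp) = conj b (diffLetter T U ((g.eta : ℂ)⁻¹) k) * (gPrimeExtEnd Gp (conj b (vPrimeConc T U g.eta A blk kQ kF sQ sF cfun) * Gp)) * (conj b (vPrimeConc T U g.eta A blk kQ kF sQ sF cfun) * Gp) := fun k => by rw [mul_assoc, hR]
  -- (3.65)/(3.66) p. 403: `Q′(U′U)G′²(U′U)Q′*(U′U) = Q′G′²Q′* + C′(A)`; (3.67): `C⁻¹(U′U) − C⁻¹(U) = −C⁻¹(U′U)C′(A)C⁻¹(U)`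
  have hCp : Qc' ∘ₗ ((gPrimeExtEnd Gp (conj b (vPrimeConc T U g.eta A blk kQ kF sQ sF cfun) * Gp)) * (gPrimeExtEnd Gp (conj b (vPrimeConc T U g.eta A blk kQ kF sQ sF cfun) * Gp))) ∘ₗ Qcs' = Qc ∘ₗ (Gp * Gp) ∘ₗ Qcs + cPrimeHom Qc Fc Qcs Fcs Gp (gPrimeExtEnd Gp (conj b (vPrimeConc T U g.eta A blk kQ kF sQ sF cfun) * Gp)) (conj b (vPrimeConc T U g.eta A blk kQ kF sQ sF cfun)) :=
    eq365b_hom Qc Qc' Fc Qcs Qcs' Fcs Gp (gPrimeExtEnd Gp (conj b (vPrimeConc T U g.eta A blk kQ kF sQ sF cfun) * Gp)) (conj b (vPrimeConc T U g.eta A blk kQ kF sQ sF cfun)) h357 h357s h365l h365r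
  have hdiff : Tinv - Linv = -(Tinv * (cPrimeHom Qc Fc Qcs Fcs Gp (gPrimeExtEnd Gp (conj b (vPrimeConc T U g.eta A blk kQ kF sQ sF cfun) * Gp)) (conj b (vPrimeConc T U g.eta A blk kQ kF sQ sF cfun)) * Linv)) := by
    rw [← mul_assoc]
    exact inv_sub_inv_of_367 (Qc ∘ₗ (Gp * Gp) ∘ₗ Qcs) (Qc' ∘ₗ ((gPrimeExtEnd Gp (conj b (vPrimeConc T U g.eta A blk kQ kF sQ sF cfun) * Gp)) * (gPrimeExtEnd Gp (conj b (vPrimeConc T U g.eta A blk kQ kF sQ sF cfun) * Gp))) ∘ₗ Qcs') _ Linv Tinv hCp hTl hLinv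
  -- rate bookkeeping: letters at `17δ₀/50`, prefix words at `3δ₀/10`, kernels at `δ₀/4`, exponents `1/100`
  have hrV : 17 / 50 * δ₀ + (1 / 100 + 1 / 100) * δ₀ ≤ δ₀ := by linarith
  have hρV0 : 0 ≤ 17 / 50 * δ₀ := by linarith
  have hr1 : 49 / 50 * δ₀ + (1 / 100 + 1 / 100) * δ₀ ≤ δ₀ := by linarith
  have hρc0 : 0 ≤ 49 / 50 * δ₀ := by linarith
  have hrC : 9 / 25 * δ₀ + (1 / 100 + 1 / 100) * δ₀ ≤ (1 - 1 / 100) * (49 / 50 * δ₀) := by linarith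
  have hρC0 : 0 ≤ 9 / 25 * δ₀ := by linarith
  have hrTL : 17 / 50 * δ₀ + (1 / 100 + 1 / 100) * δ₀ ≤ 9 / 25 * δ₀ := by linarith
  have hrXd : 17 / 50 * δ₀ + (1 / 100 + 1 / 100) * δ₀ ≤ 9 / 10 * δ₀ := by linarith
  have hrw : 3 / 10 * δ₀ + (2 * (1 / 100) + 1 / 100) * δ₀ ≤ 17 / 50 * δ₀ := by linarith
  have hrk : 1 / 4 * δ₀ + (1 / 100 + 1 / 100) * δ₀ ≤ 3 / 10 * δ₀ := by linarith
  have hρw0 : 0 ≤ 3 / 10 * δ₀ := by linarith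
  have hρk0 : 0 ≤ 1 / 4 * δ₀ := by linarith
  have h1734 : 17 / 50 * δ₀ ≤ δ₀ := by linarith
  have h17925 : 17 / 50 * δ₀ ≤ 9 / 25 * δ₀ := by linarith
  have h1445 : 1 / 4 * δ₀ ≤ 4 / 5 * δ₀ := by linarith
  -- the block-local letters (3.19)/(3.57)/(3.59): `κ = κ′ := κ_Q + c_F` (`α₁ ≦ 1`), `φ := c_F`
  have hQcκ : HasMajorantHom (g := toB6 g Rr H) (fun p : S × ι => blk p.1) (fun y : g.Site => y) Qc
      (fun a a' : g.Site => if a = a' then κQ + cF else 0) :=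
    hasMajorantHom_mono (g := toB6 g Rr H) _ _ hQc fun a a' => by
      split_ifs
      · rw [mul_one]; linarith
      · rw [mul_zero]
  have hQcsκ : HasMajorantHom (g := toB6 g Rr H) (fun y : g.Site => y) (fun p : S × ι => blk p.1) Qcs
      (fun a a' : g.Site => if a = a' then κQ + cF else 0) :=
    hasMajorantHom_mono (g := toB6 g Rr H) _ _ hQcs fun a a' => by
      split_ifs
      · rw [mul_one]; linarith
      · rw [mul_zero]
  have hQc'κ : HasMajorantHom (g := toB6 g Rr H) (fun p : S × ι => blk p.1) (fun y : g.Site => y) Qc'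
      (fun a a' : g.Site => if a = a' then κQ + cF else 0) := by
    rw [h357]
    refine hasMajorantHom_mono (g := toB6 g Rr H) _ _ (hasMajorantHom_add (g := toB6 g Rr H) _ _ hQc hFc) fun a a' => ?_
    split_ifs with hab
    · have hc : cF * α₁ ≤ cF := mul_le_of_le_one_right hcF.le hα₁one
      linarith
    · simp
  have hQcs'κ : HasMajorantHom (g := toB6 g Rr H) (fun y : g.Site => y) (fun p : S × ι => blk p.1) Qcs'
      (fun a a' : g.Site => if a = a' then κQ + cF else 0) := by
    rw [h357s]
    refine hasMajorantHom_mono (g := toB6 g Rr H) _ _ (hasMajorantHom_add (g := toB6 g Rr H) _ _ hQcs hFcs) fun a a' => ?_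
    split_ifs with hab
    · have hc : cF * α₁ ≤ cF := mul_le_of_le_one_right hcF.le hα₁one
      linarith
    · simp
  have hFcφ : HasMajorantHom (g := toB6 g Rr H) (fun p : S × ι => blk p.1) (fun y : g.Site => y) Fc
      (fun a a' : g.Site => if a = a' then cF * α₁ else 0) :=
    hasMajorantHom_mono (g := toB6 g Rr H) _ _ hFc fun a a' => by
      split_ifs
      · rw [mul_one]
      · rw [mul_zero]
  have hFcsφ : HasMajorantHom (g := toB6 g Rr H) (fun y : g.Site => y) (fun p : S × ι => blk p.1) Fcs
      (fun a a' : g.Site => if a = a' then cF * α₁ else 0) :=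
    hasMajorantHom_mono (g := toB6 g Rr H) _ _ hFcs fun a a' => by
      split_ifs
      · rw [mul_one]
      · rw [mul_zero]
  -- `C⁻¹(U′U)` (FILE 26) and `C⁻¹(U)` (Theorem 3.2): the (3.48) kernel bounds read as block majorants on 𝔅, at the letter rate `17δ₀/50`
  have hr4 : ∀ a : g.Site, g.len a ^ (-(4 : ℝ)) = (g.len a ^ 4)⁻¹ := fun a => by
    rw [Real.rpow_neg (hlen a).le, show (4 : ℝ) = ((4 : ℕ) : ℝ) by norm_num, Real.rpow_natCast]
  have hw4 : ∀ a : g.Site, 0 ≤ (g.len a ^ 4)⁻¹ := fun a => inv_nonneg.mpr (by positivity)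
  have hw4p : ∀ a : g.Site, 0 ≤ g.len a ^ 4 := fun a => by positivity
  have hl44 : ∀ a : g.Site, g.len a ^ 4 * (g.len a ^ 4)⁻¹ = 1 := fun a => mul_inv_cancel₀ (pow_ne_zero 4 (hlen a).ne')
  have hTinvM : HasMajorant (g := toB6 g Rr H) (fun y : g.Site => y) Tinv
      (fun a a' => 2 * B₁ * B6.c1 d (2 / 5 * δ₀) (1 / 10) * (g.len a ^ 4)⁻¹ * Real.exp (-(9 / 25 * δ₀ * g.dist a a'))) :=
    hasMajorant_mono (g := toB6 g Rr H) _
      (hasMajorant_id_of_ker (R := Rr) (H := H) d hlen (2 * B₁ * B6.c1 d (2 / 5 * δ₀) (1 / 10)) (fun y => g.len y ^ (-(4 : ℝ)))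
        (fun y y' => Real.exp (-(9 / 25 * δ₀ * g.dist y y'))) h348T) fun a a' => le_of_eq (by simp only [hr4])
  have hTinvW : HasMajorant (g := toB6 g Rr H) (fun y : g.Site => y) Tinv
      (fun a a' => 2 * B₁ * B6.c1 d (2 / 5 * δ₀) (1 / 10) * (g.len a ^ 4)⁻¹ * Real.exp (-(17 / 50 * δ₀ * g.dist a a'))) :=
    hasMajorant_rate_mono (R := Rr) (H := H) _ (2 * B₁ * B6.c1 d (2 / 5 * δ₀) (1 / 10)) (fun a => (g.len a ^ 4)⁻¹) hBT0 hw4 h17925 hdnn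
      hTinvM
  have hLinvM : HasMajorant (g := toB6 g Rr H) (fun y : g.Site => y) Linv
      (fun a a' => B₁ * (g.len a ^ 4)⁻¹ * Real.exp (-(δ₀ * g.dist a a'))) :=
    hasMajorant_mono (g := toB6 g Rr H) _
      (hasMajorant_id_of_ker (R := Rr) (H := H) d hlen B₁ (fun y => g.len y ^ (-(4 : ℝ)))
        (fun y y' => Real.exp (-(δ₀ * g.dist y y'))) h348) fun a a' => le_of_eq (by simp only [hr4])
  have hLinvW : HasMajorant (g := toB6 g Rr H) (fun y : g.Site => y) Linv
      (fun a a' => B₁ * (g.len a ^ 4)⁻¹ * Real.exp (-(17 / 50 * δ₀ * g.dist a a'))) :=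
    hasMajorant_rate_mono (R := Rr) (H := H) _ B₁ (fun a => (g.len a ^ 4)⁻¹) hB₁.le hw4 h1734 hdnn hLinvM
  -- (3.66) for the concrete `V′(A)` (gen 10): `C′(A) ≺ κ₃₆₆α₁(Lʲη)⁴e^{−(9δ₀/25)d}` with `κ₃₆₆(α₁) ≦ K₆`
  have hCpM : HasMajorant (g := toB6 g Rr H) (fun y : g.Site => y) (cPrimeHom Qc Fc Qcs Fcs Gp (gPrimeExtEnd Gp (conj b (vPrimeConc T U g.eta A blk kQ kF sQ sF cfun) * Gp)) (conj b (vPrimeConc T U g.eta A blk kQ kF sQ sF cfun)))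
      (fun a a' => kappa366 κQ cF (kappa385 1 (cVConc (Fintype.card κ) 1 α₁ a₀ Cq M₂ (∑ i, ‖b i‖) (Real.exp (δ₀ * d₀))) 0 0 (Λf (1 / 100)) (B6.c1 d δ₀ (1 / 100))) BG (BG * B6.c1 d (49 / 50 * δ₀) (1 / 100) * (1 - theta363 (Fintype.card κ) 1 α₁ a₀ Cq M₂ (∑ i, ‖b i‖) (Real.exp (δ₀ * d₀)) BG (Λf (1 / 100)) (B6.c1 d δ₀ (1 / 100)) * B6.c1 d (49 / 50 * δ₀) (1 / 100))⁻¹) (Λf (1 / 100)) (B6.c1 d δ₀ (1 / 100)) α₁ * α₁ * g.len a ^ 4 *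
        Real.exp (-(9 / 25 * δ₀ * g.dist a a'))) :=
    hasMajorant_cPrimeHom_vPrime (Rr := Rr) (H := H) b T U blk d hη A kQ kF sQ sF cfun w 1 d₀ M₂ Cq a₀ δ₀ δ₀ (1 / 100) (1 / 100)
      (49 / 50 * δ₀) (9 / 25 * δ₀) (Λf (1 / 100)) BG α₁ (1 / 100) κQ cF hBG.le hα₁0 hΛ0 hρc0 hρC0 (by norm_num) (by norm_num) hδ₀.le hδ₀.le hκQ.le
      hcF.le hr1 (by norm_num) (by norm_num) hrC hdnn hrefl htri hlen h261β h261c hT1 hT2 hM₂ hrepr hsmall hA' h337s' hU1 hd₀' hd₀0 hw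
      hcard hCq ha₀ hkQ hkF hsQ hsF hcfun (h1.trans hhalf) h342_1 h342_2 hQc hQcs hFc hFcs
  have hCpK : HasMajorant (g := toB6 g Rr H) (fun y : g.Site => y) (cPrimeHom Qc Fc Qcs Fcs Gp (gPrimeExtEnd Gp (conj b (vPrimeConc T U g.eta A blk kQ kF sQ sF cfun) * Gp)) (conj b (vPrimeConc T U g.eta A blk kQ kF sQ sF cfun)))
      (fun a a' => K₆ * α₁ * g.len a ^ 4 * Real.exp (-(9 / 25 * δ₀ * g.dist a a'))) :=
    hasMajorant_mono (g := toB6 g Rr H) _ hCpM fun a a' =>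
      mul_le_mul_of_nonneg_right (mul_le_mul_of_nonneg_right (mul_le_mul_of_nonneg_right hK₆α hα₁0) (hw4p a)) (Real.exp_nonneg _)
  -- (3.67): `C⁻¹(U′U) − C⁻¹(U) = −C⁻¹(U′U)·C′(A)·C⁻¹(U) ≺ B_TLα₁(Lʲη)⁻⁴e^{−(17δ₀/50)d}` by [4] (2.52)/(2.55) twice
  have hCpL : HasMajorant (g := toB6 g Rr H) (fun y : g.Site => y) (cPrimeHom Qc Fc Qcs Fcs Gp (gPrimeExtEnd Gp (conj b (vPrimeConc T U g.eta A blk kQ kF sQ sF cfun) * Gp)) (conj b (vPrimeConc T U g.eta A blk kQ kF sQ sF cfun)) * Linv)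
      (fun a a' => (K₆ * α₁ * B₁ * (Λf (1 / 100)) * B6.c1 d δ₀ (1 / 100)) * (g.len a ^ 4 * (g.len a ^ 4)⁻¹) * Real.exp (-(17 / 50 * δ₀ * g.dist a a'))) :=
    hasMajorant_comp_decay (R := Rr) (H := H) (fun y : g.Site => y) d δ₀ (1 / 100) (1 / 100) (17 / 50 * δ₀) (9 / 25 * δ₀) (Λf (1 / 100))
      (K₆ * α₁) B₁ (fun a => g.len a ^ 4) (fun a => (g.len a ^ 4)⁻¹) hw4p hw4 hΛ0 (mul_nonneg hK₆ hα₁0) hB₁.le hρV0 hrTL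
      hdnn htri hT4 h261β hCpK hLinvW
  have hSTone : ScaleTransfer g δ₀ (1 / 100) (Λf (1 / 100)) (fun _ : g.Site => (1 : ℝ)) := fun y y' => by
    simp only [mul_one]
    have h0 : 0 ≤ 1 / 100 * δ₀ * g.dist y y' := mul_nonneg (mul_nonneg (by norm_num) hδ₀.le) (hdnn y y')
    exact (Real.exp_le_one_iff.mpr (by linarith)).trans hΛ1
  have hw44 : (fun a : g.Site => g.len a ^ 4 * (g.len a ^ 4)⁻¹) = fun _ => (1 : ℝ) := funext hl44
  have hT44 : ScaleTransfer g δ₀ (1 / 100) (Λf (1 / 100)) (fun a : g.Site => g.len a ^ 4 * (g.len a ^ 4)⁻¹) := by rw [hw44]; exact hSTone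
  have hTCL : HasMajorant (g := toB6 g Rr H) (fun y : g.Site => y) (Tinv * (cPrimeHom Qc Fc Qcs Fcs Gp (gPrimeExtEnd Gp (conj b (vPrimeConc T U g.eta A blk kQ kF sQ sF cfun) * Gp)) (conj b (vPrimeConc T U g.eta A blk kQ kF sQ sF cfun)) * Linv))
      (fun a a' => (2 * B₁ * B6.c1 d (2 / 5 * δ₀) (1 / 10) * (K₆ * α₁ * B₁ * (Λf (1 / 100)) * B6.c1 d δ₀ (1 / 100)) * (Λf (1 / 100)) * B6.c1 d δ₀ (1 / 100)) *
        ((g.len a ^ 4)⁻¹ * (g.len a ^ 4 * (g.len a ^ 4)⁻¹)) * Real.exp (-(17 / 50 * δ₀ * g.dist a a'))) :=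
    hasMajorant_comp_decay (R := Rr) (H := H) (fun y : g.Site => y) d δ₀ (1 / 100) (1 / 100) (17 / 50 * δ₀) (9 / 25 * δ₀) (Λf (1 / 100))
      (2 * B₁ * B6.c1 d (2 / 5 * δ₀) (1 / 10)) (K₆ * α₁ * B₁ * (Λf (1 / 100)) * B6.c1 d δ₀ (1 / 100)) (fun a => (g.len a ^ 4)⁻¹)
      (fun a => g.len a ^ 4 * (g.len a ^ 4)⁻¹) hw4 (fun a => by rw [hl44]; exact zero_le_one) hΛ0 hBT0 (by positivity) hρV0 hrTL
      hdnn htri hT44 h261β hTinvM hCpL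
  have hTL : HasMajorant (g := toB6 g Rr H) (fun y : g.Site => y) (Tinv - Linv)
      (fun a a' => 2 * B₁ * B6.c1 d (2 / 5 * δ₀) (1 / 10) * K₆ * B₁ * (Λf (1 / 100)) * B6.c1 d δ₀ (1 / 100) * (Λf (1 / 100)) * B6.c1 d δ₀ (1 / 100) * α₁ *
        (g.len a ^ 4)⁻¹ * Real.exp (-(17 / 50 * δ₀ * g.dist a a'))) := by
    rw [hdiff]
    refine hasMajorant_mono (g := toB6 g Rr H) _ (hasMajorant_neg (R := Rr) (H := H) _ hTCL) fun a a' => le_of_eq ?_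
    rw [hl44]; ring
  -- (3.63) for `V′(A)G′(U)` (gen 9) with `θ₃₆₃ ≦ K₁α₁`, at the letter rate `17δ₀/50`
  have hVG : HasMajorant (g := toB6 g Rr H) (fun p : S × ι => blk p.1) (conj b (vPrimeConc T U g.eta A blk kQ kF sQ sF cfun) * Gp)
      (fun a a' => theta363 (Fintype.card κ) 1 α₁ a₀ Cq M₂ (∑ i, ‖b i‖) (Real.exp (δ₀ * d₀)) BG (Λf (1 / 100)) (B6.c1 d δ₀ (1 / 100)) *
        Real.exp (-(17 / 50 * δ₀ * g.dist a a'))) :=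
    ineq363_op_vPrime b T U blk d hη A kQ kF sQ sF cfun w 1 d₀ M₂ Cq a₀ δ₀ δ₀ (1 / 100) (1 / 100) (17 / 50 * δ₀) (Λf (1 / 100)) BG α₁ hBG.le hα₁0 hΛ0
      hρV0 (by norm_num) (by norm_num) hδ₀.le hδ₀.le hrV hdnn htri hlen h261β hT1 hT2 hM₂ hrepr hsmall hA' h337s' hU1 hd₀' hd₀0 hw hcard
      hCq ha₀ hkQ hkF hsQ hsF hcfun h342_1 h342_2
  have hθK : theta363 (Fintype.card κ) 1 α₁ a₀ Cq M₂ (∑ i, ‖b i‖) (Real.exp (δ₀ * d₀)) BG (Λf (1 / 100)) (B6.c1 d δ₀ (1 / 100)) ≤ K₁ * α₁ := by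
    change kappa385 BG (cVConc (Fintype.card κ) 1 α₁ a₀ Cq M₂ (∑ i, ‖b i‖) (Real.exp (δ₀ * d₀))) 0 0 (Λf (1 / 100)) (B6.c1 d δ₀ (1 / 100)) * α₁ ≤ K₁ * α₁
    exact mul_le_mul_of_nonneg_right hK₁α hα₁0
  have hVGK : HasMajorant (g := toB6 g Rr H) (fun p : S × ι => blk p.1) (conj b (vPrimeConc T U g.eta A blk kQ kF sQ sF cfun) * Gp)
      (fun a a' => K₁ * α₁ * Real.exp (-(17 / 50 * δ₀ * g.dist a a'))) :=
    hasMajorant_mono (g := toB6 g Rr H) _ hVG fun a a' => mul_le_mul_of_nonneg_right hθK (Real.exp_nonneg _)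
  -- the left letters `X·G′(U′U)` (FILE 26) and `X·(G′(U′U) − G′(U)) = (X·G′(U′U))·(V′(A)G′(U))`, `X ∈ {1, ∇_k}`, at the letter rate
  have hXE1 : HasMajorant (g := toB6 g Rr H) (fun p : S × ι => blk p.1) (gPrimeExtEnd Gp (conj b (vPrimeConc T U g.eta A blk kQ kF sQ sF cfun) * Gp))
      (fun a a' => B * g.len a ^ 2 * Real.exp (-(9 / 10 * δ₀ * g.dist a a'))) := by
    simpa only [one_mul] using hL 1 (fun a => g.len a ^ 2) (fun a => sq_nonneg _) (by simpa only [one_mul] using h342_1)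
  have hXEk : ∀ k : κ ⊕ κ, HasMajorant (g := toB6 g Rr H) (fun p : S × ι => blk p.1) (conj b (diffLetter T U ((g.eta : ℂ)⁻¹) k) * (gPrimeExtEnd Gp (conj b (vPrimeConc T U g.eta A blk kQ kF sQ sF cfun) * Gp)))
      (fun a a' => B * g.len a * Real.exp (-(9 / 10 * δ₀ * g.dist a a'))) := fun k =>
    hL _ (fun a => g.len a) (fun a => (hlen a).le) (h342_2 k)
  have hXd1 : HasMajorant (g := toB6 g Rr H) (fun p : S × ι => blk p.1) ((1 : Module.End ℝ (S × ι → ℝ)) * (gPrimeExtEnd Gp (conj b (vPrimeConc T U g.eta A blk kQ kF sQ sF cfun) * Gp) - Gp))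
      (fun a a' => B * K₁ * B6.c1 d δ₀ (1 / 100) * α₁ * g.len a ^ 2 * Real.exp (-(17 / 50 * δ₀ * g.dist a a'))) := by
    rw [hop1]
    refine hasMajorant_mono (g := toB6 g Rr H) _
      (hasMajorant_comp_decay_right1 (R := Rr) (H := H) (fun p : S × ι => blk p.1) d δ₀ (1 / 100) (1 / 100) (17 / 50 * δ₀) (9 / 10 * δ₀)
        B (K₁ * α₁) (fun a => g.len a ^ 2) (fun a => sq_nonneg _) hB (mul_nonneg hK₁ hα₁0) hρV0 (by positivity) hrXd hdnn htri h261β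
        hXE1 hVGK) fun a a' => le_of_eq (by ring)
  have hXdk : ∀ k : κ ⊕ κ, HasMajorant (g := toB6 g Rr H) (fun p : S × ι => blk p.1) (conj b (diffLetter T U ((g.eta : ℂ)⁻¹) k) * (gPrimeExtEnd Gp (conj b (vPrimeConc T U g.eta A blk kQ kF sQ sF cfun) * Gp) - Gp))
      (fun a a' => B * K₁ * B6.c1 d δ₀ (1 / 100) * α₁ * g.len a * Real.exp (-(17 / 50 * δ₀ * g.dist a a'))) := fun k => by
    rw [hopk k]
    refine hasMajorant_mono (g := toB6 g Rr H) _
      (hasMajorant_comp_decay_right1 (R := Rr) (H := H) (fun p : S × ι => blk p.1) d δ₀ (1 / 100) (1 / 100) (17 / 50 * δ₀) (9 / 10 * δ₀)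
        B (K₁ * α₁) (fun a => g.len a) (fun a => (hlen a).le) hB (mul_nonneg hK₁ hα₁0) hρV0 (by positivity) hrXd hdnn htri h261β
        (hXEk k) hVGK) fun a a' => le_of_eq (by ring)
  have hXG1 : HasMajorant (g := toB6 g Rr H) (fun p : S × ι => blk p.1) ((1 : Module.End ℝ (S × ι → ℝ)) * Gp)
      (fun a a' => BG * g.len a ^ 2 * Real.exp (-(17 / 50 * δ₀ * g.dist a a'))) := by
    rw [one_mul]
    exact hasMajorant_rate_mono (R := Rr) (H := H) _ BG (fun a => g.len a ^ 2) hBG.le (fun a => sq_nonneg _) h1734 hdnn h342_1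
  have hXGk : ∀ k : κ ⊕ κ, HasMajorant (g := toB6 g Rr H) (fun p : S × ι => blk p.1) (conj b (diffLetter T U ((g.eta : ℂ)⁻¹) k) * Gp)
      (fun a a' => BG * g.len a * Real.exp (-(17 / 50 * δ₀ * g.dist a a'))) := fun k =>
    hasMajorant_rate_mono (R := Rr) (H := H) _ BG (fun a => g.len a) hBG.le (fun a => (hlen a).le) h1734 hdnn (h342_2 k)
  -- the right letters in KERNEL form at the rate `δ₀/4`: `G′(U′U)·Y` (FILE 29) and `(G′(U′U) − G′(U))·Y` (FILE 32), `Y ∈ {1, ∇*_l}`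
  have hEY1 : HasKernelBound (g := toB6 g Rr H) (fun p : S × ι => blk p.1) v cK (gPrimeExtEnd Gp (conj b (vPrimeConc T U g.eta A blk kQ kF sQ sF cfun) * Gp) * (1 : Module.End ℝ (S × ι → ℝ)))
      (fun a a' => B' * g.len a ^ 2 * Real.exp (-(1 / 4 * δ₀ * g.dist a a'))) := by
    rw [mul_one]
    exact hasKernelBound_rate_mono (R := Rr) (H := H) _ hv cK B' (fun a => g.len a ^ 2) hB' (fun a => sq_nonneg _) h1445 hdnn hKE
  have hEYl : ∀ l : κ ⊕ κ, HasKernelBound (g := toB6 g Rr H) (fun p : S × ι => blk p.1) v cK (gPrimeExtEnd Gp (conj b (vPrimeConc T U g.eta A blk kQ kF sQ sF cfun) * Gp) * conj b (diffLetter T U ((g.eta : ℂ)⁻¹) l))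
      (fun a a' => B' * g.len a * Real.exp (-(1 / 4 * δ₀ * g.dist a a'))) := fun l =>
    hasKernelBound_rate_mono (R := Rr) (H := H) _ hv cK B' (fun a => g.len a) hB' (fun a => (hlen a).le) h1445 hdnn (hKED l)
  have hRY1 : HasKernelBound (g := toB6 g Rr H) (fun p : S × ι => blk p.1) v cK ((gPrimeExtEnd Gp (conj b (vPrimeConc T U g.eta A blk kQ kF sQ sF cfun) * Gp) - Gp) * (1 : Module.End ℝ (S × ι → ℝ)))
      (fun a a' => B₄ * α₁ * g.len a ^ 2 * Real.exp (-(1 / 4 * δ₀ * g.dist a a'))) := by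
    rw [mul_one]
    exact hasKernelBound_rate_mono (R := Rr) (H := H) _ hv cK (B₄ * α₁) (fun a => g.len a ^ 2) (mul_nonneg hB₄ hα₁0)
      (fun a => sq_nonneg _) h1445 hdnn hRk
  have hRYl : ∀ l : κ ⊕ κ, HasKernelBound (g := toB6 g Rr H) (fun p : S × ι => blk p.1) v cK ((gPrimeExtEnd Gp (conj b (vPrimeConc T U g.eta A blk kQ kF sQ sF cfun) * Gp) - Gp) * conj b (diffLetter T U ((g.eta : ℂ)⁻¹) l))
      (fun a a' => B₄ * α₁ * g.len a * Real.exp (-(1 / 4 * δ₀ * g.dist a a'))) := fun l =>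
    hasKernelBound_rate_mono (R := Rr) (H := H) _ hv cK (B₄ * α₁) (fun a => g.len a) (mul_nonneg hB₄ hα₁0) (fun a => (hlen a).le)
      h1445 hdnn (hRkD l)
  -- weight bookkeeping
  have i11 : ∀ a : g.Site, g.len a ^ 2 * (g.len a ^ 4)⁻¹ * g.len a ^ 2 = 1 := fun a => by
    have hℓ : g.len a ≠ 0 := (hlen a).ne'
    field_simp
  have i21 : ∀ a : g.Site, g.len a * (g.len a ^ 4)⁻¹ * g.len a ^ 2 = (g.len a)⁻¹ := fun a => by
    have hℓ : g.len a ≠ 0 := (hlen a).ne'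
    field_simp
  have i12 : ∀ a : g.Site, g.len a ^ 2 * (g.len a ^ 4)⁻¹ * g.len a = (g.len a)⁻¹ := fun a => by
    have hℓ : g.len a ≠ 0 := (hlen a).ne'
    field_simp
  have i22 : ∀ a : g.Site, g.len a * (g.len a ^ 4)⁻¹ * g.len a = (g.len a ^ 2)⁻¹ := fun a => by
    have hℓ : g.len a ≠ 0 := (hlen a).ne'
    field_simp
  -- the four entries (§3)
  refine ⟨?_, fun k => ?_, fun l => ?_, fun k l => ?_⟩
  · have h := hasKernelBound_pPrime_words (R := Rr) (H := H) (fun p : S × ι => blk p.1) (fun y : g.Site => y) hinj d δ₀ (1 / 100)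
      (1 / 100) (17 / 50 * δ₀) (3 / 10 * δ₀) (1 / 4 * δ₀) (Λf (1 / 100)) (κQ + cF) (κQ + cF) cF BG (B * K₁ * B6.c1 d δ₀ (1 / 100))
      (2 * B₁ * B6.c1 d (2 / 5 * δ₀) (1 / 10)) B₁
      (2 * B₁ * B6.c1 d (2 / 5 * δ₀) (1 / 10) * K₆ * B₁ * (Λf (1 / 100)) * B6.c1 d δ₀ (1 / 100) * (Λf (1 / 100)) * B6.c1 d δ₀ (1 / 100)) B' B₄ α₁
      (fun a => g.len a ^ 2) (fun a => g.len a ^ 2) (fun a => sq_nonneg _) (fun a => sq_nonneg _) hκ' hκ' hcF.le hBG.le hBXd0 hBT0 hB₁.le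
      hBTL0 hB' hB₄ hα₁0 hΛ1 hρw0 hρk0 (by norm_num) (by norm_num) hδ₀.le hrw hrk hdnn htri hrefl h261β hT2 hT4 hv hcK h357 h357s
      hXd1 hXG1 hQcκ hQcsκ hQc'κ hQcs'κ hFcφ hFcsφ hTinvW hLinvW hTL hEY1 hRY1
    simp only [one_mul, mul_one] at h
    refine hasKernelBound_mono (g := toB6 g Rr H) _ hv h fun a a' => le_of_eq ?_
    rw [i11 a]; ring
  · have h := hasKernelBound_pPrime_words (R := Rr) (H := H) (fun p : S × ι => blk p.1) (fun y : g.Site => y) hinj d δ₀ (1 / 100)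
      (1 / 100) (17 / 50 * δ₀) (3 / 10 * δ₀) (1 / 4 * δ₀) (Λf (1 / 100)) (κQ + cF) (κQ + cF) cF BG (B * K₁ * B6.c1 d δ₀ (1 / 100))
      (2 * B₁ * B6.c1 d (2 / 5 * δ₀) (1 / 10)) B₁
      (2 * B₁ * B6.c1 d (2 / 5 * δ₀) (1 / 10) * K₆ * B₁ * (Λf (1 / 100)) * B6.c1 d δ₀ (1 / 100) * (Λf (1 / 100)) * B6.c1 d δ₀ (1 / 100)) B' B₄ α₁
      (fun a => g.len a) (fun a => g.len a ^ 2) (fun a => (hlen a).le) (fun a => sq_nonneg _) hκ' hκ' hcF.le hBG.le hBXd0 hBT0 hB₁.le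
      hBTL0 hB' hB₄ hα₁0 hΛ1 hρw0 hρk0 (by norm_num) (by norm_num) hδ₀.le hrw hrk hdnn htri hrefl h261β hT2 hT4 hv hcK h357 h357s
      (hXdk k) (hXGk k) hQcκ hQcsκ hQc'κ hQcs'κ hFcφ hFcsφ hTinvW hLinvW hTL hEY1 hRY1
    simp only [mul_one] at h
    refine hasKernelBound_mono (g := toB6 g Rr H) _ hv h fun a a' => le_of_eq ?_
    rw [i21 a]
  · have h := hasKernelBound_pPrime_words (R := Rr) (H := H) (fun p : S × ι => blk p.1) (fun y : g.Site => y) hinj d δ₀ (1 / 100)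
      (1 / 100) (17 / 50 * δ₀) (3 / 10 * δ₀) (1 / 4 * δ₀) (Λf (1 / 100)) (κQ + cF) (κQ + cF) cF BG (B * K₁ * B6.c1 d δ₀ (1 / 100))
      (2 * B₁ * B6.c1 d (2 / 5 * δ₀) (1 / 10)) B₁
      (2 * B₁ * B6.c1 d (2 / 5 * δ₀) (1 / 10) * K₆ * B₁ * (Λf (1 / 100)) * B6.c1 d δ₀ (1 / 100) * (Λf (1 / 100)) * B6.c1 d δ₀ (1 / 100)) B' B₄ α₁
      (fun a => g.len a ^ 2) (fun a => g.len a) (fun a => sq_nonneg _) (fun a => (hlen a).le) hκ' hκ' hcF.le hBG.le hBXd0 hBT0 hB₁.le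
      hBTL0 hB' hB₄ hα₁0 hΛ1 hρw0 hρk0 (by norm_num) (by norm_num) hδ₀.le hrw hrk hdnn htri hrefl h261β hT1 hT4 hv hcK h357 h357s
      hXd1 hXG1 hQcκ hQcsκ hQc'κ hQcs'κ hFcφ hFcsφ hTinvW hLinvW hTL (hEYl l) (hRYl l)
    simp only [one_mul] at h
    refine hasKernelBound_mono (g := toB6 g Rr H) _ hv h fun a a' => le_of_eq ?_
    rw [i12 a]
  · have h := hasKernelBound_pPrime_words (R := Rr) (H := H) (fun p : S × ι => blk p.1) (fun y : g.Site => y) hinj d δ₀ (1 / 100)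
      (1 / 100) (17 / 50 * δ₀) (3 / 10 * δ₀) (1 / 4 * δ₀) (Λf (1 / 100)) (κQ + cF) (κQ + cF) cF BG (B * K₁ * B6.c1 d δ₀ (1 / 100))
      (2 * B₁ * B6.c1 d (2 / 5 * δ₀) (1 / 10)) B₁
      (2 * B₁ * B6.c1 d (2 / 5 * δ₀) (1 / 10) * K₆ * B₁ * (Λf (1 / 100)) * B6.c1 d δ₀ (1 / 100) * (Λf (1 / 100)) * B6.c1 d δ₀ (1 / 100)) B' B₄ α₁
      (fun a => g.len a) (fun a => g.len a) (fun a => (hlen a).le) (fun a => (hlen a).le) hκ' hκ' hcF.le hBG.le hBXd0 hBT0 hB₁.le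
      hBTL0 hB' hB₄ hα₁0 hΛ1 hρw0 hρk0 (by norm_num) (by norm_num) hδ₀.le hrw hrk hdnn htri hrefl h261β hT1 hT4 hv hcK h357 h357s
      (hXdk k) (hXGk k) hQcκ hQcsκ hQc'κ hQcs'κ hFcφ hFcsφ hTinvW hLinvW hTL (hEYl l) (hRYl l)
    refine hasKernelBound_mono (g := toB6 g Rr H) _ hv h fun a a' => le_of_eq ?_
    rw [i22 a]

end PPrimeU

/-! ## §2  Theorem 3.4, the `R(U)`-clause COMPLETE in the printed kernel form ((3.49) for `P(U′U)`, (3.68) for `P′(A)`, one `C⁻¹(U′U)`) with `a₁`, `K` chosen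
before the lattice -/

section CapstoneU

variable {𝔸 : Type*} [NormedRing 𝔸] [NormedAlgebra ℂ 𝔸] [CompleteSpace 𝔸] {ι : Type} [Fintype ι]
variable (b : Module.Basis ι ℝ 𝔸) (κ : Type) [Fintype κ]

set_option maxHeartbeats 1600000 in
/-- **THEOREM 3.4, THE `R(U)`-CLAUSE COMPLETE IN THE PRINTED KERNEL FORM, CONSTANTS BEFORE THE LATTICE** — p. 403 «the operators R(U), P(U) = I − R(U)
extend analytically to the domain (3.37) and satisfy the same bounds, e.g. the operator P(U′U) satisfies the bounds (3.49). Moreover we have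
P(U′U) = P(U) + P′(A), [(3.68)]», p. 399 «the constants … do not depend on the sequence {Ω_j}»: `∃ a₁ > 0 ∃ K ≧ 0 ∀ (lattice 𝔅 = g, background U,
data, Theorems 3.1/3.2 for U incl. the kernel members, (3.19) letters with a section) ∀ α₁ ≦ a₁ ∀ A ∈ (3.37) ∀ kF sF ∀ (3.57)/(3.59) letters`: THERE
EXISTS `C⁻¹(U′U)`, two-sided inverse of `Q′(U′U)G′²(U′U)Q′*(U′U)` on 𝔅, with `P(U′U) = P(U) + P′(A)`, the four (3.49) kernel bounds
`[|P(U′U)(x,x′)|, |(∇_kP(U′U))(x,x′)|, |(P(U′U)∇*_l)(x,x′)|, |(∇_kP(U′U)∇*_l)(x,x′)|] ≦ K[1, (Lʲη)⁻¹, (Lʲη)⁻¹, (Lʲη)⁻²]e^{−(δ₀/5)d(y,y′)}v(y′)⁻¹` (FILE 51)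
AND the four (3.68) kernel bounds `[|P′(A)(x,x′)|, …] ≦ Kα₁[1, (Lʲη)⁻¹, (Lʲη)⁻¹, (Lʲη)⁻²]e^{−(δ₀/5)d(y,y′)}v(y′)⁻¹` (§1) — FILE 33
`thm34_R_kernel_final` verbatim, re-quantified; FILE 51's and §1's `C⁻¹(U′U)` coincide since a two-sided inverse is unique.
[cite: Balaban1985BackgroundPropagators, Thm 3.4 p.400 + p.399 + (3.49) p.399 + (3.68) p.403 + (3.25) p.394 + Thm 3.1 (3.42) p.397 + Thm 3.2 (3.48) p.398 + (3.57)–(3.67) pp.401–403 + (3.37) p.396; Balaban1984PropagatorsII, Lemma 2.1 p.234 + (2.51)–(2.55) p.232] -/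
theorem thm34_R_kernel_uniform [DecidableEq ι] (d : ℕ)
    (δ₀ κQ BG B₁ cF Cq a₀ d₀ M₂ : ℝ) (Λf : ℝ → ℝ)
    (hκQ : 0 < κQ) (hBG : 0 < BG) (hB₁ : 0 < B₁) (hcF : 0 < cF) (hCq : 0 ≤ Cq) (ha₀ : 0 ≤ a₀) (hM₂ : 0 ≤ M₂) (hδ₀ : 0 < δ₀) (hΛf : ∀ α : ℝ, 0 < α → 1 ≤ Λf α)
    (hrepr : ∀ (v : 𝔸) (i : ι), |b.repr v i| ≤ M₂ * ‖v‖) :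
    ∃ a₁ : ℝ, 0 < a₁ ∧ ∃ K : ℝ, 0 ≤ K ∧
    ∀ {S : Type} [Fintype S] [DecidableEq S] (T : κ → Equiv.Perm S) (U : κ → S → 𝔸ˣ)
      {g : B9.Geometry} [Fintype g.Site] [DecidableEq g.Site] [Nonempty g.Site] {Rr : ℝ} {H : Prop} (blk : S → g.Site)
      (kQ : g.Site → S → 𝔸 →L[ℝ] 𝔸) (sQ : S → 𝔸 →L[ℝ] 𝔸) (cfun w : g.Site → ℝ)
    -- the multiscale geometry 𝔅 and its axioms
    (hdnn : ∀ a a' : g.Site, 0 ≤ g.dist a a') (htri : Triangle254 (toB6 g Rr H)) (hrefl : ∀ y : g.Site, g.dist y y = 0)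
    (hsym : ∀ y y' : g.Site, g.dist y y' = g.dist y' y) (hlen : ∀ y : g.Site, 0 < g.len y) (hlenη : ∀ y : g.Site, g.eta ≤ g.len y)
    (hη : 0 < g.eta)
    -- [4] Lemma 2.1 (2.61) at the rate `δ₀`, «for every 0 < α < 1», and the p. 398 scale transfer for every exponent
    (h261 : ∀ α : ℝ, 0 < α → α < 1 → Ineq261 d (toB6 g Rr H) δ₀ α)
      (hST : ∀ α : ℝ, 0 < α → ScaleTransfer g δ₀ α (Λf α) (fun a => g.len a) ∧ ScaleTransfer g δ₀ α (Λf α) (fun a => g.len a ^ 2) ∧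
        ScaleTransfer g δ₀ α (Λf α) (fun a => (g.len a)⁻¹) ∧ ScaleTransfer g δ₀ α (Λf α) (fun a => (g.len a ^ 2)⁻¹) ∧
        ScaleTransfer g δ₀ α (Λf α) (fun a => (g.len a ^ 4)⁻¹) ∧ ScaleTransfer g δ₀ α (Λf α) (fun y => g.len y ^ (-(4 : ℝ))))
    (hU1 : ∀ m z, ‖((U m z : 𝔸ˣ) : 𝔸)‖ ≤ 1 ∧ ‖(((U m z)⁻¹ : 𝔸ˣ) : 𝔸)‖ ≤ 1)
    (hd₀B : ∀ μ x, g.dist (blk x) (blk ((T μ).symm x)) ≤ d₀) (hd₀F : ∀ μ x, g.dist (blk x) (blk (T μ x)) ≤ d₀)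
    (hd₀0 : ∀ y : g.Site, g.dist y y ≤ d₀)
    -- the `A`-independent data of the concrete `V′(A)` of (3.60)
    (hw : ∀ y, 0 ≤ w y) (hcard : ∀ y, ((B9Eq360Vprime.block blk y).card : ℝ) * w y ≤ 1)
    (hkQ : ∀ y x, blk x = y → ‖kQ y x‖ ≤ w y) (hsQ : ∀ x, ‖sQ x‖ ≤ 1) (hcfun : ∀ y, |cfun y| ≤ a₀ * (g.len y ^ 2)⁻¹)
    -- THEOREM 3.1 for `G′(U)`: (3.42)₁,₂,₃ at the rate `δ₀`
    {Gp : Module.End ℝ (S × ι → ℝ)}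
    (h342_1 : HasMajorant (g := toB6 g Rr H) (fun p : S × ι => blk p.1) Gp
      (fun a a' => BG * g.len a ^ 2 * Real.exp (-(δ₀ * g.dist a a'))))
    (h342_2 : ∀ k : κ ⊕ κ, HasMajorant (g := toB6 g Rr H) (fun p : S × ι => blk p.1)
      (conj b (diffLetter T U ((g.eta : ℂ)⁻¹) k) * Gp) (fun a a' => BG * g.len a * Real.exp (-(δ₀ * g.dist a a'))))
    (h342_3 : ∀ k : κ ⊕ κ, HasMajorant (g := toB6 g Rr H) (fun p : S × ι => blk p.1)
      (Gp * conj b (diffLetter T U ((g.eta : ℂ)⁻¹) k)) (fun a a' => BG * g.len a * Real.exp (-(δ₀ * g.dist a a'))))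
    -- the (3.19) letters `Q′(U)`, `Q′*(U)` in their own typing with block-local two-space majorants, a section of the block map (FILE 17)
    (rep : g.Site → S × ι) (hrep : ∀ y : g.Site, blk (rep y).1 = y)
    {Qc : (S × ι → ℝ) →ₗ[ℝ] (g.Site → ℝ)} {Qcs : (g.Site → ℝ) →ₗ[ℝ] (S × ι → ℝ)} {Linv : Module.End ℝ (g.Site → ℝ)}
    (hQc : HasMajorantHom (g := toB6 g Rr H) (fun p : S × ι => blk p.1) (fun y : g.Site => y) Qc
      (fun a a' : g.Site => κQ * (if a = a' then (1 : ℝ) else 0)))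
    (hQcs : HasMajorantHom (g := toB6 g Rr H) (fun y : g.Site => y) (fun p : S × ι => blk p.1) Qcs
      (fun a a' : g.Site => κQ * (if a = a' then (1 : ℝ) else 0)))
    -- THEOREM 3.2 for `U`: (3.21) `C⁻¹ = (Q′G′²Q′*)⁻¹` exists (`hLinv`) with the KERNEL bound (3.48) at the rate `δ₀`
    (hLinv : (Qc ∘ₗ (Gp * Gp) ∘ₗ Qcs) * Linv = 1)
    (h348 : ∀ y y' : g.Site, |B9Thm34Inv.ker (B9Thm34Inv.vol g d) Linv y y'| ≤
      B₁ * g.len y ^ (-(4 : ℝ)) * g.len y' ^ (-(d : ℝ)) * Real.exp (-(δ₀ * g.dist y y')))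
    -- THEOREM 3.1 for `G′(U)`: the letter `Δ′_a(U)` with `G′(U)` its two-sided inverse ((3.26); FILE 26)
    {Δp : Module.End ℝ (S × ι → ℝ)} (hΔpGp : Δp * Gp = 1) (hGpΔp : Gp * Δp = 1)
    -- the kernel pairing of p. 393 (`c = η^d`, block volume weight `v(y′) = (L^{j′}η)^d`) and THEOREM 3.1's (3.42)₁₋₄ FOR `G′(U)` IN THE PRINTED KERNEL FORM
    {v : g.Site → ℝ} (hv : ∀ y, 0 < v y) {cK : ℝ} (hcK : 0 < cK)
    (hGpk : HasKernelBound (g := toB6 g Rr H) (fun p : S × ι => blk p.1) v cK Gp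
      (fun a a' => BG * g.len a ^ 2 * Real.exp (-(δ₀ * g.dist a a'))))
    (hDGpk : ∀ k : κ ⊕ κ, HasKernelBound (g := toB6 g Rr H) (fun p : S × ι => blk p.1) v cK
      (conj b (diffLetter T U ((g.eta : ℂ)⁻¹) k) * Gp) (fun a a' => BG * g.len a * Real.exp (-(δ₀ * g.dist a a'))))
    (hGpDk : ∀ l : κ ⊕ κ, HasKernelBound (g := toB6 g Rr H) (fun p : S × ι => blk p.1) v cK
      (Gp * conj b (diffLetter T U ((g.eta : ℂ)⁻¹) l)) (fun a a' => BG * g.len a * Real.exp (-(δ₀ * g.dist a a'))))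
    (hDGpDk : ∀ k l : κ ⊕ κ, HasKernelBound (g := toB6 g Rr H) (fun p : S × ι => blk p.1) v cK
      (conj b (diffLetter T U ((g.eta : ℂ)⁻¹) k) * Gp * conj b (diffLetter T U ((g.eta : ℂ)⁻¹) l)) (fun a a' => BG * Real.exp (-(δ₀ * g.dist a a')))),
    ∀ (α₁ : ℝ), 0 ≤ α₁ → α₁ ≤ a₁ →
    -- the exponent field `A` in the domain (3.37), read blockwise, and the `A`-dependent (3.59) data `kF`, `sF`
    ∀ (A : κ → S → 𝔸) (kF : g.Site → S → 𝔸 →L[ℝ] 𝔸) (sF : S → 𝔸 →L[ℝ] 𝔸),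
      (∀ y x, blk x = y → ‖kF y x‖ ≤ Cq * α₁ * w y) → (∀ x, ‖sF x‖ ≤ Cq * α₁) →
      (∀ ν k x, ‖((g.eta : ℂ)⁻¹) • covDstar T U ν (A k) x‖ ≤ α₁ * (g.len (blk x) ^ 2)⁻¹) →
      (∀ μ ν x, ‖((g.eta : ℂ)⁻¹) • covD T U μ (A ν) x‖ ≤ α₁ * (g.len (blk x) ^ 2)⁻¹) →
      (∀ μ x, ‖((g.eta : ℂ)⁻¹) • covDstar T U μ (tauB T U μ (A μ)) x‖ ≤ α₁ * (g.len (blk x) ^ 2)⁻¹) →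
      (∀ k x, ‖A k x‖ ≤ α₁ * (g.len (blk x))⁻¹) → (∀ ν k x, ‖tauB T U ν (A k) x‖ ≤ α₁ * (g.len (blk x))⁻¹) →
    -- the (3.57)/(3.59) letters `F′₂(A)`, `F′₂*(A)` (block-local, size `c_F α₁`)
    ∀ {Qc' Fc : (S × ι → ℝ) →ₗ[ℝ] (g.Site → ℝ)} {Qcs' Fcs : (g.Site → ℝ) →ₗ[ℝ] (S × ι → ℝ)},
      Qc' = Qc + Fc → Qcs' = Qcs + Fcs →
      HasMajorantHom (g := toB6 g Rr H) (fun p : S × ι => blk p.1) (fun y : g.Site => y) Fc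
        (fun a a' : g.Site => cF * α₁ * (if a = a' then (1 : ℝ) else 0)) →
      HasMajorantHom (g := toB6 g Rr H) (fun y : g.Site => y) (fun p : S × ι => blk p.1) Fcs
        (fun a a' : g.Site => cF * α₁ * (if a = a' then (1 : ℝ) else 0)) →
    ∃ Tinv : Module.End ℝ (g.Site → ℝ),
      Tinv * (Qc' ∘ₗ ((gPrimeExtEnd Gp (conj b (vPrimeConc T U g.eta A blk kQ kF sQ sF cfun) * Gp)) * (gPrimeExtEnd Gp (conj b (vPrimeConc T U g.eta A blk kQ kF sQ sF cfun) * Gp))) ∘ₗ Qcs') = 1 ∧ (Qc' ∘ₗ ((gPrimeExtEnd Gp (conj b (vPrimeConc T U g.eta A blk kQ kF sQ sF cfun) * Gp)) * (gPrimeExtEnd Gp (conj b (vPrimeConc T U g.eta A blk kQ kF sQ sF cfun) * Gp))) ∘ₗ Qcs') * Tinv = 1 ∧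
      -- (3.68), first line: `P(U′U) = P(U) + P′(A)`
      pOp (gPrimeExtEnd Gp (conj b (vPrimeConc T U g.eta A blk kQ kF sQ sF cfun) * Gp)) (Qcs' ∘ₗ secRes rep) (secConj rep Tinv) (secExt rep ∘ₗ Qc') = pOp Gp (Qcs ∘ₗ secRes rep) (secConj rep Linv) (secExt rep ∘ₗ Qc) + pPrime Gp (gPrimeExtEnd Gp (conj b (vPrimeConc T U g.eta A blk kQ kF sQ sF cfun) * Gp)) (Qcs ∘ₗ secRes rep) (Qcs' ∘ₗ secRes rep) (secConj rep Linv) (secConj rep Tinv) (secExt rep ∘ₗ Qc) (secExt rep ∘ₗ Qc') ∧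
      -- (3.49) for `P(U′U)` in the printed kernel form (FILE 30)
      HasKernelBound (g := toB6 g Rr H) (fun p : S × ι => blk p.1) v cK (pOp (gPrimeExtEnd Gp (conj b (vPrimeConc T U g.eta A blk kQ kF sQ sF cfun) * Gp)) (Qcs' ∘ₗ secRes rep) (secConj rep Tinv) (secExt rep ∘ₗ Qc'))
        (fun a a' => K * Real.exp (-(1 / 5 * δ₀ * g.dist a a'))) ∧
      (∀ k : κ ⊕ κ, HasKernelBound (g := toB6 g Rr H) (fun p : S × ι => blk p.1) v cK (conj b (diffLetter T U ((g.eta : ℂ)⁻¹) k) * pOp (gPrimeExtEnd Gp (conj b (vPrimeConc T U g.eta A blk kQ kF sQ sF cfun) * Gp)) (Qcs' ∘ₗ secRes rep) (secConj rep Tinv) (secExt rep ∘ₗ Qc'))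
        (fun a a' => K * (g.len a)⁻¹ * Real.exp (-(1 / 5 * δ₀ * g.dist a a')))) ∧
      (∀ l : κ ⊕ κ, HasKernelBound (g := toB6 g Rr H) (fun p : S × ι => blk p.1) v cK (pOp (gPrimeExtEnd Gp (conj b (vPrimeConc T U g.eta A blk kQ kF sQ sF cfun) * Gp)) (Qcs' ∘ₗ secRes rep) (secConj rep Tinv) (secExt rep ∘ₗ Qc') * conj b (diffLetter T U ((g.eta : ℂ)⁻¹) l))
        (fun a a' => K * (g.len a)⁻¹ * Real.exp (-(1 / 5 * δ₀ * g.dist a a')))) ∧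
      (∀ k l : κ ⊕ κ, HasKernelBound (g := toB6 g Rr H) (fun p : S × ι => blk p.1) v cK (conj b (diffLetter T U ((g.eta : ℂ)⁻¹) k) * pOp (gPrimeExtEnd Gp (conj b (vPrimeConc T U g.eta A blk kQ kF sQ sF cfun) * Gp)) (Qcs' ∘ₗ secRes rep) (secConj rep Tinv) (secExt rep ∘ₗ Qc') * conj b (diffLetter T U ((g.eta : ℂ)⁻¹) l))
        (fun a a' => K * (g.len a ^ 2)⁻¹ * Real.exp (-(1 / 5 * δ₀ * g.dist a a')))) ∧
      -- (3.68) for `P′(A)` in the printed kernel form, with the factor `α₁` (§4)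
      HasKernelBound (g := toB6 g Rr H) (fun p : S × ι => blk p.1) v cK (pPrime Gp (gPrimeExtEnd Gp (conj b (vPrimeConc T U g.eta A blk kQ kF sQ sF cfun) * Gp)) (Qcs ∘ₗ secRes rep) (Qcs' ∘ₗ secRes rep) (secConj rep Linv) (secConj rep Tinv) (secExt rep ∘ₗ Qc) (secExt rep ∘ₗ Qc'))
        (fun a a' => K * α₁ * Real.exp (-(1 / 5 * δ₀ * g.dist a a'))) ∧
      (∀ k : κ ⊕ κ, HasKernelBound (g := toB6 g Rr H) (fun p : S × ι => blk p.1) v cK (conj b (diffLetter T U ((g.eta : ℂ)⁻¹) k) * pPrime Gp (gPrimeExtEnd Gp (conj b (vPrimeConc T U g.eta A blk kQ kF sQ sF cfun) * Gp)) (Qcs ∘ₗ secRes rep) (Qcs' ∘ₗ secRes rep) (secConj rep Linv) (secConj rep Tinv) (secExt rep ∘ₗ Qc) (secExt rep ∘ₗ Qc'))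
        (fun a a' => K * α₁ * (g.len a)⁻¹ * Real.exp (-(1 / 5 * δ₀ * g.dist a a')))) ∧
      (∀ l : κ ⊕ κ, HasKernelBound (g := toB6 g Rr H) (fun p : S × ι => blk p.1) v cK (pPrime Gp (gPrimeExtEnd Gp (conj b (vPrimeConc T U g.eta A blk kQ kF sQ sF cfun) * Gp)) (Qcs ∘ₗ secRes rep) (Qcs' ∘ₗ secRes rep) (secConj rep Linv) (secConj rep Tinv) (secExt rep ∘ₗ Qc) (secExt rep ∘ₗ Qc') * conj b (diffLetter T U ((g.eta : ℂ)⁻¹) l))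
        (fun a a' => K * α₁ * (g.len a)⁻¹ * Real.exp (-(1 / 5 * δ₀ * g.dist a a')))) ∧
      (∀ k l : κ ⊕ κ, HasKernelBound (g := toB6 g Rr H) (fun p : S × ι => blk p.1) v cK (conj b (diffLetter T U ((g.eta : ℂ)⁻¹) k) * pPrime Gp (gPrimeExtEnd Gp (conj b (vPrimeConc T U g.eta A blk kQ kF sQ sF cfun) * Gp)) (Qcs ∘ₗ secRes rep) (Qcs' ∘ₗ secRes rep) (secConj rep Linv) (secConj rep Tinv) (secExt rep ∘ₗ Qc) (secExt rep ∘ₗ Qc') * conj b (diffLetter T U ((g.eta : ℂ)⁻¹) l))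
        (fun a a' => K * α₁ * (g.len a ^ 2)⁻¹ * Real.exp (-(1 / 5 * δ₀ * g.dist a a')))) := by
  classical
  obtain ⟨a₁, ha₁, K₁, hK₁, h30⟩ := thm34_P_kernel_uniform b κ d δ₀ κQ BG B₁ cF Cq a₀ d₀ M₂ Λf hκQ hBG hB₁ hcF hCq ha₀ hM₂ hδ₀ hΛf hrepr
  obtain ⟨a₂, ha₂, K₂, hK₂, h33⟩ := thm34_pPrime_kernel_uniform b κ d δ₀ κQ BG B₁ cF Cq a₀ d₀ M₂ Λf hκQ hBG hB₁ hcF hCq ha₀ hM₂ hδ₀ hΛf hrepr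
  refine ⟨min a₁ a₂, lt_min ha₁ ha₂, K₁ + K₂, add_nonneg hK₁ hK₂, ?_⟩
  -- NOW the lattice, the background, the data, the Theorems-for-`U` inputs (block and kernel members); then `α₁`, `A` and the `A`-letters
  intro S _ _ T U g _ _ _ Rr H blk kQ sQ cfun w hdnn htri hrefl hsym hlen hlenη hη h261 hST hU1 hd₀B hd₀F hd₀0 hw hcard hkQ hsQ hcfun Gp h342_1
    h342_2 h342_3 rep hrep Qc Qcs Linv hQc hQcs hLinv h348 Δp hΔpGp hGpΔp v hv cK hcK hGpk hDGpk hGpDk hDGpDk α₁ hα₁0 hα₁1 A kF sF hkF hsF h337B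
    h337F h337Bτ hA hAτB Qc' Fc Qcs' Fcs h357 h357s hFc hFcs
  replace h30 := h30 T U blk kQ sQ cfun w hdnn htri hrefl hsym hlen hlenη hη h261 hST hU1 hd₀B hd₀F hd₀0 hw hcard hkQ hsQ hcfun h342_1 h342_2 h342_3
    rep hrep hQc hQcs hLinv h348 hΔpGp hGpΔp hv hcK hGpk hDGpk hGpDk hDGpDk
  replace h33 := h33 T U blk kQ sQ cfun w hdnn htri hrefl hsym hlen hlenη hη h261 hST hU1 hd₀B hd₀F hd₀0 hw hcard hkQ hsQ hcfun h342_1 h342_2 h342_3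
    rep hrep hQc hQcs hLinv h348 hΔpGp hGpΔp hv hcK hGpk hDGpk hGpDk hDGpDk
  obtain ⟨T₁, hT₁l, hT₁r, hP1, hP2, hP3, hP4⟩ := h30 α₁ hα₁0 (hα₁1.trans (min_le_left _ _)) A kF sF hkF hsF h337B h337F h337Bτ hA hAτB
    h357 h357s hFc hFcs
  obtain ⟨T₂, hT₂l, hT₂r, h368, hQ1, hQ2, hQ3, hQ4⟩ := h33 α₁ hα₁0 (hα₁1.trans (min_le_right _ _)) A kF sF hkF hsF h337B h337F h337Bτ hA
    hAτB h357 h357s hFc hFcs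
  -- a two-sided inverse is unique: FILE 30's `C⁻¹(U′U)` is §4's
  have hTT : T₁ = T₂ :=
    calc T₁ = T₁ * ((Qc' ∘ₗ ((gPrimeExtEnd Gp (conj b (vPrimeConc T U g.eta A blk kQ kF sQ sF cfun) * Gp)) * (gPrimeExtEnd Gp (conj b (vPrimeConc T U g.eta A blk kQ kF sQ sF cfun) * Gp))) ∘ₗ Qcs') * T₂) := by rw [hT₂r, mul_one]
      _ = (T₁ * (Qc' ∘ₗ ((gPrimeExtEnd Gp (conj b (vPrimeConc T U g.eta A blk kQ kF sQ sF cfun) * Gp)) * (gPrimeExtEnd Gp (conj b (vPrimeConc T U g.eta A blk kQ kF sQ sF cfun) * Gp))) ∘ₗ Qcs')) * T₂ := (mul_assoc _ _ _).symm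
      _ = T₂ := by rw [hT₁l, one_mul]
  rw [hTT] at hP1 hP2 hP3 hP4
  -- constant and rate bookkeeping: `K₁, K₂ ≦ K₁ + K₂`, `e^{−(δ₀/4)d} ≦ e^{−(δ₀/5)d}`
  have hw1 : ∀ a : g.Site, 0 ≤ (g.len a)⁻¹ := fun a => inv_nonneg.mpr (hlen a).le
  have hw2 : ∀ a : g.Site, 0 ≤ (g.len a ^ 2)⁻¹ := fun a => inv_nonneg.mpr (sq_nonneg _)
  have hexp : ∀ a a' : g.Site, Real.exp (-(1 / 4 * δ₀ * g.dist a a')) ≤ Real.exp (-(1 / 5 * δ₀ * g.dist a a')) := fun a a' => by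
    have h0 : 0 ≤ δ₀ * g.dist a a' := mul_nonneg hδ₀.le (hdnn a a')
    exact Real.exp_le_exp.mpr (by linarith)
  have hK1 : K₁ ≤ K₁ + K₂ := by linarith
  have hK12 : K₂ * α₁ ≤ (K₁ + K₂) * α₁ := mul_le_mul_of_nonneg_right (by linarith) hα₁0
  have hKα : 0 ≤ (K₁ + K₂) * α₁ := mul_nonneg (add_nonneg hK₁ hK₂) hα₁0
  refine ⟨T₂, hT₂l, hT₂r, h368, ?_, fun k => ?_, fun l => ?_, fun k l => ?_, ?_, fun k => ?_, fun l => ?_, fun k l => ?_⟩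
  · exact hasKernelBound_mono (g := toB6 g Rr H) _ hv hP1 fun a a' => mul_le_mul_of_nonneg_right hK1 (Real.exp_nonneg _)
  · exact hasKernelBound_mono (g := toB6 g Rr H) _ hv (hP2 k) fun a a' =>
      mul_le_mul_of_nonneg_right (mul_le_mul_of_nonneg_right hK1 (hw1 a)) (Real.exp_nonneg _)
  · exact hasKernelBound_mono (g := toB6 g Rr H) _ hv (hP3 l) fun a a' =>
      mul_le_mul_of_nonneg_right (mul_le_mul_of_nonneg_right hK1 (hw1 a)) (Real.exp_nonneg _)
  · exact hasKernelBound_mono (g := toB6 g Rr H) _ hv (hP4 k l) fun a a' =>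
      mul_le_mul_of_nonneg_right (mul_le_mul_of_nonneg_right hK1 (hw2 a)) (Real.exp_nonneg _)
  · exact hasKernelBound_mono (g := toB6 g Rr H) _ hv hQ1 fun a a' => mul_le_mul hK12 (hexp a a') (Real.exp_pos _).le hKα
  · exact hasKernelBound_mono (g := toB6 g Rr H) _ hv (hQ2 k) fun a a' =>
      mul_le_mul (mul_le_mul_of_nonneg_right hK12 (hw1 a)) (hexp a a') (Real.exp_pos _).le (mul_nonneg hKα (hw1 a))
  · exact hasKernelBound_mono (g := toB6 g Rr H) _ hv (hQ3 l) fun a a' =>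
      mul_le_mul (mul_le_mul_of_nonneg_right hK12 (hw1 a)) (hexp a a') (Real.exp_pos _).le (mul_nonneg hKα (hw1 a))
  · exact hasKernelBound_mono (g := toB6 g Rr H) _ hv (hQ4 k l) fun a a' =>
      mul_le_mul (mul_le_mul_of_nonneg_right hK12 (hw2 a)) (hexp a a') (Real.exp_pos _).le (mul_nonneg hKα (hw2 a))

end CapstoneU

end Literature.MathematicalPhysics.QuantumFieldTheory.Balaban1983to89.B9Thm34PPrimeKernelUniform

end
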